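import Summits.AtomisticToContinuum.BoseEinsteinCondensation.Theses.BECStronglyRayleigh
import Summits.AtomisticToContinuum.BoseEinsteinCondensation.Theses.BECPeriodicReduction
import Literature.Barriers.AtomisticToContinuum.KineticGapLengthScalesFreeGas
import Literature.Barriers.AtomisticToContinuum.KineticGapLengthScalesThermodynamicWindow
import Literature.MathematicalPhysics.QuantumLattice.XYOrderGDProofs
import Literature.MathematicalPhysics.QuantumManyBody.BoseGasCatStates
import Literature.MathematicalPhysics.QuantumManyBody.PeriodicBoseGasThm31
import Literature.MathematicalPhysics.QuantumManyBody.PeriodicBoseGasMomentumSector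

/-!
# Disproof of `LatticeToPeriodicBridge` (stmt-AtomisticToContinuum-9674) — standing adversary, gen 1–2

Crux (route BECStronglyRayleigh, rank 4):
`LatticeToPeriodicBridge := KineticLatticeBEC → PeriodicBEC`, where

* the antecedent `A = KineticLatticeBEC` (the route's rank-0 TARGET, = stmt-5008's shared signature)
  is uniform ground-state BEC of HARD-CORE lattice bosons (spin-½ ferromagnetic XY model
  `xyTorus 3 L 1 = -Σ(S¹S¹+S²S²)`, hopping `t = ½`) on the even tori `(ℤ/Lℤ)³` at EVERY filling
  `1 ≤ N ≤ L³/2`: `⟨S⁺_tot S⁻_tot⟩ = L³·n_{k=0} ≥ c·N·L³`, the sector being selected by the penalty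
  `4L³(S³_tot + L³/2 - N)²` (> spectral width `3L³`); read back symbol by symbol: `S³ = diag(½,-½)`,
  index `0` = up = occupied, `[S¹,S²] = iS³` so `S⁺_totS⁻_tot = (S¹_tot)²+(S²_tot)²+S³_tot` and
  `S³_tot = N - L³/2` on the sector — no junk; this is LSSY's open problem "BEC at fillings ≠ ½"
  (only `N = L³/2` is a theorem, KLS 1988 / ALSSY 2004, via reflection positivity);
* the consequent `B` is VERBATIM `BECPeriodicReduction.PeriodicBEC` (stmt-0826's body,
  `crux_iff` below is `Iff.rfl`): for every repulsive finite-range `v`, `∃ρ₀ ∀ρ<ρ₀ ∃c>0 ∀ᶠN ∃δ>0`,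
  every periodic `δ`-near-minimiser on the torus of side `L_N = (N/ρ)^{1/3}` has `n₀ ≥ cN`.

## Findings (index)

* §1 LOGIC. `crux_iff`; `crux_of_periodicBEC` (B → crux: the crux is formally WEAKER than
  stmt-0826); `crux_of_not_kinetic` (¬A → crux); `not_crux_iff : ¬crux ↔ A ∧ ¬B` — ANY DISPROOF
  MUST (a) PROVE uniform hard-core lattice BEC at all fillings ≤ ½ (the route's own open target) AND
  (b) exhibit an admissible `v` for which torus ground-state BEC FAILS at arbitrarily small density
  (`exists_badPotential_of_not_crux`). Neither half is within reach of present knowledge; (b) is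
  believed false for every admissible `v` (dilute Lee–Huang–Yang regime). VERDICT: RESISTS.
* §2 LOAD-BEARING ANALYSIS. One hypothesis only. `WithoutKinetic := B` (`without_iff`); it is
  stmt-0826, open — no `_false_without_` theorem can exist short of refuting dilute BEC itself.
  Conversely, modulo `A` (believed true) the crux IS stmt-0826 (`crux_iff_without_of_kinetic`):
  the implication buys nothing unless a proof genuinely consumes the lattice input.
* §3 NO FREE-GAS EXIT. `consequentAt_zero` (sibling disprover's `periodicBEC_antecedent_free`,
  Barriers/KineticGapLengthScalesFreeGas): `B(0)` holds, so a bad potential is `≠ 0`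
  (`badPotential_ne_zero`); and `E₀^per < ⊤` eventually at small density for every admissible `v`
  (`exists_eventually_periodicGroundStateEnergy_lt_top`, Ruelle), so `B(v)` is never vacuous nor
  trivially false through `E₀ = ⊤` (hard cores, hollow shells, fat-Cantor cores included).
* §4 EVERY WINDOWED BRIDGE IS EQUIVALENT TO `¬A`. If the consequent is strengthened to an
  energy-WINDOW certificate (`⟨Ψ,HΨ⟩ ≤ E₀^per + w_ρ(N)` ⇒ `n₀ ≥ cN`) with any super-gap window
  (`w` eventually `> 4π²M²N/L_N²` for every `M`; e.g. `κN`, `κL_N²`, or a density-dependent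
  `κ(ρ)N` such as Fournais's `C₀aρ(ρa³)^{1/2-ε}N`), the bridge becomes `↔ ¬KineticLatticeBEC`
  (`bridgeWindow_iff_not_kinetic`, `bridgeDensityWindow_iff_not_kinetic`): a proof of the bridge
  that outputs a window certificate on the thermodynamic torus would REFUTE the route's own target.
  So mechanism (ii) (Josephson array of Fournais/Junge boxes) can only ever use
  `Fournais2020_condensation_holds` on SUB-boxes `ℓ ≍ (ρa)^{-1/2}(ρa³)^{-δ} ≪ L_N`
  (`not_densityWindow_at_thermodynamicBox`), after which the inter-box coherence problem is a NEW
  lattice problem (soft-core, filling `ρℓ³ → ∞`, face couplings) that is NOT the filed antecedent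
  `A` (hard-core, n.n., filling ≤ ½): under (ii) the antecedent is unused and the crux is
  stmt-0826 outright.
* §5 THE ANTECEDENT IS CONSUMED ONLY IN ITS DILUTE CORNER by mechanism (i) (optical-lattice depth
  homotopy at spacing `b = 2R₀(v)`, filling `ν = ρb³ ≤ ρ₀(v)b³`, and the prover may shrink `ρ₀`):
  `KineticLatticeBECBelow ν` (A restricted to `N ≤ νL³`), `below_of_kinetic`,
  `crux_of_diluteBridge` — a bridge from `A_ν` for ONE `ν > 0` already gives the crux. The
  "all fillings ≤ ½" strength of `A` (the part needing InsertionFieldDelocalisation up to half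
  filling) is dead weight for this item; but `A_ν` (dilute hard-core lattice BEC, `N = νL³ → ∞`)
  is itself open (LSSY Ch. 11: only ν = ½), so no cheapening results; and at ν = ½ the lattice
  input is a tree THEOREM (KLS, `kennedy_lieb_shastry_xy_ground_holds`), so a half-filling bridge
  is `↔ PeriodicBEC` (`bridgeFromKLS_iff`): the implication form adds nothing in either corner.
* §6 WHY IT RESISTS / what a proof must build (prose census): no declaration in the tree relates
  the `Matrix`/`groundStateFunctional` world of `A` to the `PeriodicTrialState`/`lintegral` world of
  `B`; a proof needs a many-body tight-binding CONVERGENCE theorem for an ORDER PARAMETER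
  (`λ_max(γ)`; NOT `n₀`, which a deep lattice destroys even for the free gas: Bloch ≠ constant mode)
  plus a comparison sign in the depth (route BECLatticeDepthHomotopy's `LatticeOnlyDepletes`, open),
  or a second-scale coherence theorem (ii). Literature: no transfer of condensate fractions across
  a continuum ↔ lattice limit is in print (searches logged in NOTES.md).

LANDED (gen 1): `Summits/AtomisticToContinuum/BoseEinsteinCondensation/Theorems/LatticeToPeriodicBridge/
Negative/WindowedBridge.lean` — p74248 ACCEPTED (commit a0dcf37ec863): `not_crux_iff`,
`ConsequentAt`, `exists_badPotential_of_not_crux`, `badPotential_ne_zero`, `BridgeWindow`,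
`bridgeWindow_iff_not_kinetic`, `not_bridge{Macroscopic,Surface}Window_of_kinetic`,
`densityWindow_superGap`, `not_densityWindow_at_thermodynamicBox`,
`bridgeDensityWindow_iff_not_kinetic` (namespace `…Theorems.LatticeToPeriodicBridge.Negative`;
ideators / planners may import it). §1–§4 below duplicate those decls in this work namespace.

GEN 2 (2026-08-16, this seat; §7–§9 below):
* §7 NO `v`-UNIFORM DENSITY THRESHOLD (natural strengthening `∃ρ₀ ∀v` of the consequent):
  `periodicGroundStateEnergy_hardCorePotential_eq_top` (torus hard spheres beyond close packing:
  `E₀^per = ⊤`, every state is a near-minimiser), `threshold_le_of_consequentAt_hardCorePotential`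
  (TIGHTNESS: any `ρ₀` for `hardCorePotential a` is `≤ 8/a³`), `not_uniformConsequent`,
  `bridgeUniform_iff_not_kinetic` (uniform-threshold bridge ↔ ¬A). LANDED as
  `Theorems/LatticeToPeriodicBridge/Negative/UniformThreshold.lean` — p77205 ACCEPTED (p76026 was
  an infrastructure bounce of the same file). A proof of the crux must let `ρ₀` depend on `v` (at
  least on its hard-core radius); the EXACT dilation covariance `ρ₀(b⁻²v(·/b)) = ρ₀(v)/b³` and the
  reduction of the consequent AND of the crux to unit-range potentials (`crux_iff_unitRange`) are
  landed as `Negative/ScalingReduction.lean` — p78254 (resubmission of the infrastructure bounces p77459/p77944,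
  unchanged content; pending at publication).
* §8 THE ROUND-1 IDEA CARDS, first lemmas attacked (cards `coarse-cell-lorentzian`,
  `coarse-cell-hardcore-floor`, `muffin-tin-reward-supermodularity`):
  (a) `coarse-cell-lorentzian`: its typed First lemma `TwoBodyCellLorentzian` (near-minimiser
      form, IdeatorSketch1.lean) is FALSE AS TYPED — at `v = 0` (admissible) the flat kernel of the
      free minimiser sits on the BOUNDARY of the Lorentzian cone and `δ`-near-minimisers leave it:
      `reverseCauchySchwarz_fails_near_flat` / `bumpKernel_not_lorentzian` (finite-dimensional
      cores) + `not_twoBodyCellLorentzian` = `not_cardTwoBodyCellLorentzian` (SORRY-FREE continuum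
      witness `Ψ_ε = k_ε(1 + ε|Θ_per|²)`, `Θ` = cat-state block pair dilated into one half-cell,
      `M = 2`; the trigonometric variant `c(1 + ε sin sin)` of the prose is the same mechanism).
      LANDED: `Negative/TwoBodyWitness.lean` p77275 ACCEPTED (witness data + energy bound);
      `Negative/TwoBodyCellLorentzian.lean` p77411 ACCEPTED (the refutation, reviewer-checked by
      hand; nit recorded: the test vector is `u = e_0 - e_{(1,1,1)}`).
      Classification: MISSTATED — repair `0 < scatteringLength v` (Fournais's standing hypothesis)
      or the exact-minimiser form (as `PairCellLorentzian` already is); the witness misses both.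
      `IntegratedPairCoherence` and `PairCellLorentzian` survive `v = 0` (factor-2 slack at the
      flat kernel; constant minimiser). So on this line positivity of the scattering length is
      LOAD-BEARING already at `N = 2`, and `δ = δ(v, b, M)` must shrink with `a(v)`.
  (b) `coarse-cell-hardcore-floor`: First lemmas `CoarseModesCarryAlmostAll` / `CrossCellPoincare`
      are Poincaré–Wirtinger facts with the sharp Neumann constant `(b/π)²` and the cross-cell
      constant `2b²` (checked by hand: equality for `cos(πMx₁/L)`, ratio `sin⁴θ/(2θ⁴) ≤ ½` on plane
      waves) — consistent, not attackable; the bet `CoarseHardCoreFloor` is `∀ᶠ N` and sandwiched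
      by PeriodicBEC-with-constant (fraction `≥ 0.4(1-η) - η` eventually): as hard as stmt-0826, no
      finite computation decides it; no junk (`xyZeroModeWeight 2 1 = 8`, `M³`-normalisation right).
  (c) `muffin-tin-reward-supermodularity`: the typed LDM₀ `WallsOnlyDeplete` quantifies over ALL
      `(L, b, w)` — incommensurate `L/b` and `b > L` included (the glue only uses `L = M·b`); no junk
      corner found (`E = ⊤` makes both sides `0`; `N = 0, 1` fine; unique positive ground states).
      Fine-grid ED scan of `n₀(λ)`-monotonicity for `N = 1, 2, 3`, `d = 1, 2, 3`, soft and hard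
      cores, commensurate AND incommensurate geometries: kit job j010771 (results in §8c docstring
      when available / attached to the item). Heuristic recorded: the only `n₀`-INCREASING
      mechanism found on paper is an avoided crossing between two inequivalent wells (ground state
      spread over both at the crossing), which the rigid typed geometry (equal wells + one defect
      well or one thick wall per direction) does not offer at `N = 1`.
* §9 census update for provers/planners.

Prose only in docstrings; every `theorem` is `lean check`ed (rc 0, no `sorry`).
-/

noncomputable section

namespace Summit.AtomisticToContinuum.BoseEinsteinCondensation.Cruxes.LatticeToPeriodicBridge.Disproof

open Literature.MathematicalPhysics.QuantumManyBody.BoseGas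
open Literature.Barriers.AtomisticToContinuum.BoseGas
open _root_.MeasureTheory _root_.Filter _root_.Topology
open scoped ENNReal NNReal

open Summit.AtomisticToContinuum.BoseEinsteinCondensation.Theses
open Summit.AtomisticToContinuum.BoseEinsteinCondensation.Theses.BECStronglyRayleigh

/-! ## §1 Logic of the crux -/

/-- The crux is literally `KineticLatticeBEC → PeriodicBEC` (the consequent is stmt-0826's body,
shared verbatim with route BECPeriodicReduction). [folklore] -/
theorem crux_iff :
    LatticeToPeriodicBridge ↔ (KineticLatticeBEC → BECPeriodicReduction.PeriodicBEC) :=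
  Iff.rfl

/-- The crux is implied by its consequent alone: it is formally weaker than stmt-0826.
[folklore] -/
theorem crux_of_periodicBEC (h : BECPeriodicReduction.PeriodicBEC) : LatticeToPeriodicBridge :=
  fun _ => h

/-- … and ex falso by a refutation of the route's own target (uniform hard-core lattice BEC). No
such refutation is in sight (numerically `n₀/N` is bounded below at every filling ≤ ½ in `d = 3`).
[folklore] -/
theorem crux_of_not_kinetic (h : ¬ KineticLatticeBEC) : LatticeToPeriodicBridge :=
  fun hA => absurd hA h

/-- **Negation normal form**: a disproof of the crux is exactly a proof of the lattice target
together with a refutation of periodic BEC. [folklore] -/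
theorem not_crux_iff :
    ¬ LatticeToPeriodicBridge ↔ (KineticLatticeBEC ∧ ¬ BECPeriodicReduction.PeriodicBEC) := by
  rw [crux_iff]
  tauto

/-- Any disproof proves the route's rank-0 target (LSSY's open lattice problem). [folklore] -/
theorem kinetic_of_not_crux (h : ¬ LatticeToPeriodicBridge) : KineticLatticeBEC :=
  (not_crux_iff.1 h).1

/-- … and refutes stmt-0826. [folklore] -/
theorem not_periodicBEC_of_not_crux (h : ¬ LatticeToPeriodicBridge) :
    ¬ BECPeriodicReduction.PeriodicBEC :=
  (not_crux_iff.1 h).2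

/-- The body of the consequent at a fixed potential `v` (= the sibling disprover's `AntecedentAt`
for PeriodicToDirichlet; here it is the CONSEQUENT). [folklore] -/
def ConsequentAt (v : ℝ → ℝ≥0∞) : Prop :=
  ∃ ρ₀ : ℝ, 0 < ρ₀ ∧ ∀ ρ : ℝ, 0 < ρ → ρ < ρ₀ → ∃ c : ℝ, 0 < c ∧ ∀ᶠ N : ℕ in atTop,
    ∃ δ : ℝ≥0∞, 0 < δ ∧ ∀ Ψ : PeriodicTrialState N (sideLength ρ N),
      periodicEnergy v Ψ ≤ periodicGroundStateEnergy v N (sideLength ρ N) + δ →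
        ENNReal.ofReal (c * N) ≤ condensateOccupation N (sideLength ρ N) Ψ.ψ

/-- `PeriodicBEC ↔ ∀ v admissible, ConsequentAt v`. [folklore] -/
theorem periodicBEC_iff :
    BECPeriodicReduction.PeriodicBEC ↔ ∀ v, IsRepulsiveFiniteRange v → ConsequentAt v :=
  Iff.rfl

/-- **What a kill needs on the continuum side**: an admissible potential for which torus
ground-state BEC fails at arbitrarily small density. [folklore] -/
theorem exists_badPotential_of_not_crux (h : ¬ LatticeToPeriodicBridge) :
    ∃ v : ℝ → ℝ≥0∞, IsRepulsiveFiniteRange v ∧ ¬ ConsequentAt v := by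
  have h' := not_periodicBEC_of_not_crux h
  rw [periodicBEC_iff] at h'
  push Not at h'
  exact h'

/-! ## §2 Load-bearing analysis: the single hypothesis

Dropping `KineticLatticeBEC` leaves stmt-0826 itself. It cannot be refuted here (open; believed
true), so there is no `_false_without_` theorem; what CAN be said is that modulo the antecedent the
crux is exactly stmt-0826. -/

/-- The crux with its only hypothesis dropped. [folklore] -/
def WithoutKinetic : Prop :=
  BECPeriodicReduction.PeriodicBEC

/-- `WithoutKinetic` is stmt-0826 verbatim. [folklore] -/
theorem without_iff : WithoutKinetic ↔ BECPeriodicReduction.PeriodicBEC :=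
  Iff.rfl

/-- Modulo the (believed true, open) lattice target, the crux IS periodic BEC: the implication form
buys nothing unless a proof genuinely consumes the lattice input. [folklore] -/
theorem crux_iff_without_of_kinetic (hA : KineticLatticeBEC) :
    LatticeToPeriodicBridge ↔ WithoutKinetic :=
  ⟨fun h => h hA, fun h _ => h⟩

/-! ## §3 No free-gas exit, no `E₀ = ⊤` junk -/

/-- The consequent holds for the free gas (`v = 0`): sibling disprover's theorem (Poincaré at gap
scale, `c = ½`, `δ_N = κN/L_N²`). [folklore] -/
theorem consequentAt_zero : ConsequentAt 0 :=
  periodicBEC_antecedent_free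

/-- Hence a potential witnessing a disproof is not the zero potential. [folklore] -/
theorem badPotential_ne_zero {v : ℝ → ℝ≥0∞} (h : ¬ ConsequentAt v) : v ≠ 0 := by
  rintro rfl
  exact h consequentAt_zero

/-- The `v = 0` instance of the bridge holds without touching the hypothesis. [folklore] -/
theorem crux_pointwise_zero : KineticLatticeBEC → ConsequentAt 0 :=
  fun _ => consequentAt_zero

/-- No `E₀ = ⊤` junk in the consequent: for every admissible `v` (hard cores included) the periodic
ground-state energy on the thermodynamic torus is finite eventually, at every small density
(Ruelle; sibling disprover, Barriers/KineticGapLengthScalesThermodynamicWindow). So the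
near-minimiser hypothesis of `B` is never satisfied by ALL states for junk reasons. [folklore] -/
theorem consequent_energy_finite {v : ℝ → ℝ≥0∞} (hv : IsRepulsiveFiniteRange v) :
    ∃ ρ₁ : ℝ, 0 < ρ₁ ∧ ∀ ρ : ℝ, 0 < ρ → ρ < ρ₁ →
      ∀ᶠ N : ℕ in atTop, periodicGroundStateEnergy v N (sideLength ρ N) < ⊤ :=
  exists_eventually_periodicGroundStateEnergy_lt_top hv

/-! ## §4 Every windowed bridge is equivalent to `¬ KineticLatticeBEC`

Natural strengthening of the consequent: replace the unknown slack `δ_N` by an explicit energy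
WINDOW `w ρ N` (what any energy-estimate-driven proof — Fournais boxes, IMS localisation, trial-state
surgery — would actually certify). By the Galilei-boost obstruction (sibling disprover,
`not_periodicBEC_window`) the windowed consequent is FALSE for every super-gap window, already at
`v = 0`; hence the windowed bridge holds iff the antecedent fails. -/

/-- The bridge with a windowed consequent. [folklore] -/
def BridgeWindow (w : ℝ → ℕ → ℝ≥0∞) : Prop :=
  KineticLatticeBEC →
    ∀ v : ℝ → ℝ≥0∞, IsRepulsiveFiniteRange v → ∃ ρ₀ : ℝ, 0 < ρ₀ ∧ ∀ ρ : ℝ, 0 < ρ → ρ < ρ₀ →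
      ∃ c : ℝ, 0 < c ∧ ∀ᶠ N : ℕ in atTop, ∀ Ψ : PeriodicTrialState N (sideLength ρ N),
        periodicEnergy v Ψ ≤ periodicGroundStateEnergy v N (sideLength ρ N) + w ρ N →
          ENNReal.ofReal (c * N) ≤ condensateOccupation N (sideLength ρ N) Ψ.ψ

/-- **Windowed bridge ↔ ¬(lattice target)** for every super-gap window. [folklore] -/
theorem bridgeWindow_iff_not_kinetic {w : ℝ → ℕ → ℝ≥0∞}
    (hw : ∀ ρ : ℝ, 0 < ρ → ∀ M : ℕ, ∀ᶠ N : ℕ in atTop,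
      ENNReal.ofReal (4 * Real.pi ^ 2 * M ^ 2 / sideLength ρ N ^ 2 * N) < w ρ N) :
    BridgeWindow w ↔ ¬ KineticLatticeBEC :=
  ⟨fun h hA => not_periodicBEC_window hw (h hA), fun h hA => absurd hA h⟩

/-- In particular the lattice target REFUTES every macroscopic-window bridge (`w = κN`).
[folklore] -/
theorem not_bridgeMacroscopicWindow_of_kinetic (hA : KineticLatticeBEC) {κ : ℝ} (hκ : 0 < κ) :
    ¬ BridgeWindow (fun _ N => ENNReal.ofReal (κ * N)) := by
  intro h
  exact not_periodicBEC_macroscopicWindow hκ (h hA)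

/-- … and every surface-window bridge (`w = κL_N²`, the order of the interacting Dirichlet wall).
[folklore] -/
theorem not_bridgeSurfaceWindow_of_kinetic (hA : KineticLatticeBEC) {κ : ℝ} (hκ : 0 < κ) :
    ¬ BridgeWindow (fun ρ N => ENNReal.ofReal (κ * sideLength ρ N ^ 2)) := by
  intro h
  exact not_periodicBEC_surfaceWindow hκ (h hA)

/-- Gap bookkeeping for DENSITY-DEPENDENT macroscopic windows `κ(ρ)·N` (Fournais's (1.8) has
`κ(ρ) = C₀aρ(ρa³)^{1/2-ε}`): they are super-gap along the thermodynamic box. [folklore] -/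
theorem densityWindow_superGap {κ : ℝ → ℝ} (hκ : ∀ ρ : ℝ, 0 < ρ → 0 < κ ρ) :
    ∀ ρ : ℝ, 0 < ρ → ∀ M : ℕ, ∀ᶠ N : ℕ in atTop,
      ENNReal.ofReal (4 * Real.pi ^ 2 * M ^ 2 / sideLength ρ N ^ 2 * N) <
        ENNReal.ofReal (κ ρ * N) := by
  intro ρ hρ M
  refine eventually_gap_lt hρ M ?_
  have h2 : Tendsto (fun N : ℕ => κ ρ * ρ * sideLength ρ N ^ 2) atTop atTop :=
    ((tendsto_pow_atTop two_ne_zero).comp (tendsto_sideLength_atTop hρ)).const_mul_atTop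
      (mul_pos (hκ ρ hρ) hρ)
  refine (tendsto_congr' ?_).mpr h2
  filter_upwards [eventually_gt_atTop 0] with N hN
  have hL : 0 < sideLength ρ N := sideLength_pos_of_pos hρ hN
  rw [natCast_eq_mul_sideLength_pow_three hρ hN]
  field_simp

/-- **No Fournais-type statement at the thermodynamic box**, for every admissible `v`
individually: with ANY density-dependent macroscopic window `κ(ρ)N`, `κ(ρ) > 0`, there is no
`ρ₀ > 0` below which "energy `≤ E₀^per + κ(ρ)N` ⇒ `n₀ ≥ cN` eventually" holds. (Fournais 2020
Thm 1.2 — proved in the tree, `Fournais2020_condensation_holds` — lives on boxes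
`C_L(ρa³)^{-δ}(ρa)^{-1/2}`, not on `L_N = (N/ρ)^{1/3}`; this is the formal reason.) [folklore] -/
theorem not_densityWindow_at_thermodynamicBox {v : ℝ → ℝ≥0∞} (hv : IsRepulsiveFiniteRange v)
    {κ : ℝ → ℝ} (hκ : ∀ ρ : ℝ, 0 < ρ → 0 < κ ρ) :
    ¬ (∃ ρ₀ : ℝ, 0 < ρ₀ ∧ ∀ ρ : ℝ, 0 < ρ → ρ < ρ₀ →
        ∃ c : ℝ, 0 < c ∧ ∀ᶠ N : ℕ in atTop, ∀ Ψ : PeriodicTrialState N (sideLength ρ N),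
          periodicEnergy v Ψ ≤
              periodicGroundStateEnergy v N (sideLength ρ N) + ENNReal.ofReal (κ ρ * N) →
            ENNReal.ofReal (c * N) ≤ condensateOccupation N (sideLength ρ N) Ψ.ψ) :=
  not_periodicBEC_window_pointwise hv (w := fun ρ N => ENNReal.ofReal (κ ρ * N))
    (densityWindow_superGap hκ)

/-- **Density-window bridge ↔ ¬(lattice target)**. [folklore] -/
theorem bridgeDensityWindow_iff_not_kinetic {κ : ℝ → ℝ} (hκ : ∀ ρ : ℝ, 0 < ρ → 0 < κ ρ) :
    BridgeWindow (fun ρ N => ENNReal.ofReal (κ ρ * N)) ↔ ¬ KineticLatticeBEC :=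
  bridgeWindow_iff_not_kinetic (densityWindow_superGap hκ)

/-- Sanity converse: the genuine crux is NOT of this form — its slack `δ_N` is existential, and
shrinking it only weakens the hypothesis on `Ψ`; the windowed bridges above are strictly stronger
statements (they imply the crux whenever the window is positive). [folklore] -/
theorem crux_of_bridgeWindow {w : ℝ → ℕ → ℝ≥0∞} (hw0 : ∀ ρ N, 0 < w ρ N) (h : BridgeWindow w) :
    LatticeToPeriodicBridge := by
  intro hA v hv
  obtain ⟨ρ₀, hρ₀, hρ⟩ := h hA v hv
  refine ⟨ρ₀, hρ₀, fun ρ hρpos hρlt => ?_⟩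
  obtain ⟨c, hc, hev⟩ := hρ ρ hρpos hρlt
  exact ⟨c, hc, hev.mono fun N hN => ⟨w ρ N, hw0 ρ N, hN⟩⟩

/-! ## §5 The antecedent is consumed only in its dilute corner (mechanism (i)) -/

/-- `KineticLatticeBEC` restricted to fillings `N ≤ νL³`. [folklore] -/
def KineticLatticeBECBelow (ν : ℝ) : Prop :=
  ∃ c : ℝ, 0 < c ∧ ∃ L₀ : ℕ, ∀ (L : ℕ) [NeZero L], L₀ ≤ L → Even L → ∀ N : ℕ, 1 ≤ N →
    (N : ℝ) ≤ ν * (L : ℝ) ^ 3 → 2 * N ≤ L ^ 3 →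
      c * N * (L : ℝ) ^ 3 ≤
        ((Literature.MathematicalPhysics.QuantumLattice.xyTorus 3 L 1 +
          (((3 + 1) * L ^ 3 : ℕ) : ℂ) •
            (Literature.MathematicalPhysics.QuantumLattice.totalSpin 1 2 +
              ((L : ℂ) ^ 3 / 2 - (N : ℂ)) • 1) ^ 2).groundStateFunctional
          (Literature.MathematicalPhysics.QuantumLattice.totalSpin 1 0 *
              Literature.MathematicalPhysics.QuantumLattice.totalSpin 1 0 +
            Literature.MathematicalPhysics.QuantumLattice.totalSpin 1 1 *
              Literature.MathematicalPhysics.QuantumLattice.totalSpin 1 1)).re +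
          N - (L : ℝ) ^ 3 / 2

/-- The filed antecedent gives every dilute restriction (same constants). [folklore] -/
theorem below_of_kinetic (h : KineticLatticeBEC) (ν : ℝ) : KineticLatticeBECBelow ν := by
  obtain ⟨c, hc, L₀, hL⟩ := h
  exact ⟨c, hc, L₀, fun L _ hL₀ hE N hN _ h2N => hL L hL₀ hE N hN h2N⟩

/-- **A bridge from ONE dilute corner already gives the crux.** Mechanism (i) (depth homotopy at
spacing `b = 2R₀(v)`, filling `ν = ρb³`, with `ρ₀(v)` at the prover's disposal) can only ever
invoke the antecedent through some `KineticLatticeBECBelow ν`, `ν > 0` arbitrary: the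
"all fillings ≤ ½" strength of the target is not used by this item. [folklore] -/
theorem crux_of_diluteBridge {ν : ℝ}
    (h : KineticLatticeBECBelow ν → BECPeriodicReduction.PeriodicBEC) :
    LatticeToPeriodicBridge :=
  fun hA => h (below_of_kinetic hA ν)

/-- Restriction is monotone in the filling cap. [folklore] -/
theorem below_mono {ν ν' : ℝ} (hνν' : ν ≤ ν') (h : KineticLatticeBECBelow ν') :
    KineticLatticeBECBelow ν := by
  obtain ⟨c, hc, L₀, hL⟩ := h
  refine ⟨c, hc, L₀, fun L _ hL₀ hE N hN hν h2N => hL L hL₀ hE N hN ?_ h2N⟩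
  exact hν.trans (mul_le_mul_of_nonneg_right hνν' (by positivity))

/-- At cap `ν = ½` the restriction is the full antecedent (the cap `N ≤ L³/2` is already there).
[folklore] -/
theorem below_half_iff : KineticLatticeBECBelow (1 / 2) ↔ KineticLatticeBEC := by
  constructor
  · rintro ⟨c, hc, L₀, hL⟩
    refine ⟨c, hc, L₀, fun L _ hL₀ hE N hN h2N => hL L hL₀ hE N hN ?_ h2N⟩
    have : (2 * N : ℝ) ≤ (L : ℝ) ^ 3 := by exact_mod_cast h2N
    linarith
  · exact fun h => below_of_kinetic h _

/-- **The half-filling corner needs no antecedent at all.** The half-filling slice of lattice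
BEC is already a THEOREM in the tree — Kennedy–Lieb–Shastry in its native form
(`kennedy_lieb_shastry_xy_ground_holds`: even-torus LRO of the tracial XY ground state, all
`d ≥ 2`, all spins). So a bridge whose lattice input is only the half-filled gas (the corner where
the depth comparison of mechanism (i) has slack `N/2`, cf. route BECLatticeDepthHomotopy) has a
PROVABLE antecedent and is equivalent to `PeriodicBEC` outright: the implication form adds
nothing there either. [folklore] -/
theorem bridgeFromKLS_iff :
    (Literature.MathematicalPhysics.QuantumLattice.kennedy_lieb_shastry_xy_ground →
        BECPeriodicReduction.PeriodicBEC) ↔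
      BECPeriodicReduction.PeriodicBEC :=
  ⟨fun h => h Literature.MathematicalPhysics.QuantumLattice.kennedy_lieb_shastry_xy_ground_holds,
    fun h _ => h⟩

/-! ## §6 Why the crux resists, and what a proof must build (census for provers)

VERDICT: RESISTS. `¬crux ↔ A ∧ ¬B` (`not_crux_iff`). (a) `A` = uniform BEC of hard-core lattice
bosons on `(ℤ/Lℤ)³` at all fillings ≤ ½ — LSSY 2005 Ch. 11's open problem off half filling; no
refutation is conceivable on present evidence (QMC: `n₀/N ≳ 0.4`–`1` across fillings in `d = 3`),
and no proof either (that IS the route). (b) `¬B` needs an admissible `v` with NO torus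
ground-state BEC at arbitrarily small density: believed false for every repulsive finite-range `v`
(dilute regime `ρa³ → 0`, `ρR₀³ → 0`: Bogoliubov depletion `∝ √(ρa³) → 0`); junk exits checked and
closed — `v = 0` satisfies `B` (§3), `E₀^per < ⊤` eventually so the near-minimiser clause is never
all-of-`Ψ` (§3), hollow-shell / caged potentials (`v = ⊤` on `[R₁,R₀]`, `0` inside) reduce at small
density to the all-apart hard-sphere sector (caged clusters cost `O(1/R₁²)` per particle against
`4πaρ → 0`), `PeriodicTrialState N L_N` is non-empty (constants), `n₀ ≤ N`, `δ = ⊤` only hurts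
the prover. Both sides carry `∃L₀`/`∀ᶠN`: no finite computation decides either.

WHAT IS DEAD (formally, §4): any proof architecture whose continuum output is an energy-window
certificate on the thermodynamic torus (energy within `w_N` of `E₀^per` ⇒ condensed) with `w_N`
beyond one kinetic gap per particle — this includes consuming `Fournais2020_condensation_holds` at
`L = L_N`, IMS gluing errors `≥ N/ℓ²`, and trial-state surgery with macroscopic or surface-order
slack: such a bridge is equivalent to `¬A`.

WHAT THE TWO INTENDED MECHANISMS REALLY NEED.
 (i) Depth homotopy (cf. route BECLatticeDepthHomotopy, which types it at half filling): an
     auxiliary optical lattice `c·ΣW_b(x_i)`, `b = 2R₀(v)` so that the deep end is the n.n.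
     hard-core gas at filling `ν = ρb³`; needs (α) a many-body TIGHT-BINDING CONVERGENCE theorem
     for the mode-free order parameter `λ_max(γ)` at fixed finite volume (Feshbach–Schur onto the
     lowest Wannier band, uniformly in `N ≤ νL³` — not in print for `N → ∞` with the volume), (β)
     a COMPARISON SIGN `liminf_c Λ(c) ≤ Λ(0)` ("a lattice only depletes"; open, no monotonicity
     or convexity in `c` is known; Hellmann–Feynman gives `dE/dc ≥ 0`, nothing on `γ`), (γ) mode
     identification `λ_max = n₀` at `c = 0` (translation invariance; provable), and it consumes `A`
     only as `A_ν`, `ν → 0` (§5) — where `A_ν` is as open as `A`. NOTE the order parameter must be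
     `λ_max`, not `n₀`: for the FREE gas in a deep lattice `n₀/N = |⟨φ₀,u₀⟩|² → 0` (Bloch ground
     state `u₀` concentrates in wells) while `λ_max = N`.
 (ii) Josephson array of Fournais/Junge boxes: sub-boxes `ℓ ≪ L_N` each condensed by
     `Fournais2020_condensation_holds` (window `C₀aρ(ρa³)^{1/2-ε}N_box` IS admissible at scale `ℓ`),
     then global coherence across `(L_N/ℓ)³ → ∞` boxes: a soft-core Bose–Hubbard-type problem at
     filling `ρℓ³ → ∞` with face couplings — the route's "Theorem S, soft-core form" is listed under
     NOT DECOMPOSED YET, and the delocalisation input would be a new K1 one scale up. The filed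
     antecedent `A` (hard core, filling ≤ ½) does not enter: under (ii) the crux is stmt-0826.

QUANTITATIVE CHECK OF (i)'S COMPARISON SIGN (Bogoliubov level, heuristic; numbers in NOTES.md
§mech-i). Exotic `v` do not break the deep end: for hollow cores (`v = 0` on `[0,R₁)`) the on-site
repulsion `U_c ~ exp(-(πR₁²/2b)√c)` still beats the hopping `t_c ~ exp(-(2b/π)√c)` whenever
`b > πR₁/2 ≈ 1.57R₁` (true for `b = 2R₀` and for `b → ∞`), so the tight-binding end is the
n.n. HARD-CORE gas for every admissible `v ≠ 0` a.e. But at SMALL filling both ends are dilute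
gases whose depletions are `≈ 1.5045√(ρa³)` (continuum, scattering length `a = a(v) ≤ R₀`) and
`≈ 1.5045√(ρa_latt³)` with `a_latt = b/(2πW₃) = 0.3148·b` (hard-core bosons on the simple cubic
lattice; `W₃ = 0.505462` Watson, `T(U→∞) = 4t/W₃`, `T = 8πta`). Hence `Λ(0) ≥ Λ(∞)` at leading
order iff `a ≤ 0.3148·b`; with the docstring's `b = 2R₀(v)` this reads `a ≤ 0.63R₀` and is
PREDICTED FALSE for hard spheres (`a = R₀`: continuum depletion `0.53√ν` > lattice `0.265√ν`).
Taking `b ≥ max(2R₀, 3.18a)` (e.g. `b = 4R₀`) restores the predicted sign, but only with slack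
`(a_latt/a)^{3/2}` between two `O(√ν)` quantities: "a lattice only depletes" is NOT a structural
fact in the dilute corner — it is a comparison of scattering lengths. At HALF filling instead
(route BECLatticeDepthHomotopy, `b = (2ρ)^{-1/3} → ∞`) Tóth's bound `λ_max ≤ N(L³-N+1)/L³` caps
the deep end at `N/2·(1+o(1))` against `Λ(0) = N(1-O(√(ρa³)))`: slack `N/2`, safe — but there the
lattice input is KLS, already a theorem in the tree, so `A` (all fillings) is superfluous. EITHER
WAY THE FILED ANTECEDENT DOES LITTLE WORK: under (i) it is consumed as `A_ν`, `ν → 0`, exactly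
where the comparison has no structural slack, or at `ν = ½` where it is not needed; under (ii) it
is unused. Toy (by hand, 1-D, `g = ∞`, 4 wells, `N = 2`): hard-core ring `λ_max = ½+4ab+2a² =
1.457` (`a = 1/(2√2)`, `b = ½`) vs Tonks ring `λ₀ = 16/π² = 1.621`: sign holds with 10% margin in
the extreme toy; no small-model violation found.

WHAT IS ALIVE: exactly the two programmes above, each of the depth of stmt-0826 itself; the honest
reading of this item is "PeriodicBEC, with the lattice theorem available as a black box at the far
end of a limit nobody controls yet". Recommendation to planners (not a restatement request): if
(i) is the intent, the bridge could be SPLIT as `A_ν → DeepLatticeFloor_ν` (tight-binding, (α)) and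
`LatticeOnlyDepletes_ν` ((β), shared in spirit with route BECLatticeDepthHomotopy) — then (β) is the
crux a refuter can actually attack (small-`N` ED of `Λ(c)` monotonicity; see NOTES.md §toy).
-/


/-! ## §7 No `v`-uniform density threshold (gen 2; landed as `Negative/UniformThreshold.lean`, p77205 ACCEPTED)

The consequent quantifies `∀ v admissible, ∃ ρ₀ > 0, ∀ ρ < ρ₀ …`. Its natural strengthening with
`∃ ρ₀` IN FRONT of `∀ v` is false, and quantitatively `ρ₀(hardCorePotential a) ≤ 8/a³`: above
`8/a³` more than `⌈2L_N/a⌉³` hard spheres sit in the fundamental cell, two of them overlap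
(pigeonhole), `E₀^per = ⊤`, every periodic state is a `δ`-near-minimiser for every `δ`, and the
fragmented cat states of `BoseGasCatStates` (`n₀ ≤ N/m³`) defeat every `c > 0`. The theorems of
this section are verbatim those of the landed file, kept here so that this work file stays
self-contained. -/

/-- Pigeonhole in the closed-open cell `[0,L)³`: if `N > ⌈2L/a⌉³`, every configuration in
`cellN N L` has two particles at distance `< a`. [folklore] -/
theorem exists_dist_lt_of_ceil_pow_lt_of_mem_cellN {a : ℝ} (ha : 0 < a) {L : ℝ} {N : ℕ}
    (hN : ⌈2 * L / a⌉₊ ^ 3 < N) {X : Config N} (hX : X ∈ cellN N L) :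
    ∃ i j : Fin N, i ≠ j ∧ dist (X i) (X j) < a := by
  set m : ℕ := ⌈2 * L / a⌉₊ with hm
  have hcell : ∀ (i : Fin N) (k : Fin 3), ⌊2 * X i k / a⌋₊ < m := by
    intro i k
    have hx : X i k ∈ Set.Ico 0 L := hX i k
    rw [Nat.floor_lt (by have := hx.1; positivity)]
    calc 2 * X i k / a < 2 * L / a := by
          exact div_lt_div_of_pos_right (by linarith [hx.2]) ha
      _ ≤ m := Nat.le_ceil _
  let c : Fin N → Fin 3 → Fin m := fun i k => ⟨⌊2 * X i k / a⌋₊, hcell i k⟩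
  have hcard : Fintype.card (Fin 3 → Fin m) < Fintype.card (Fin N) := by
    simpa [Fintype.card_fun, Fintype.card_fin] using hN
  obtain ⟨i, j, hij, hc⟩ := Fintype.exists_ne_map_eq_of_card_lt c hcard
  refine ⟨i, j, hij, ?_⟩
  have hcoord : ∀ k : Fin 3, dist (X i k) (X j k) < a / 2 := by
    intro k
    have hk : ⌊2 * X i k / a⌋₊ = ⌊2 * X j k / a⌋₊ := by
      have := congr_fun hc k
      simpa [c, Fin.ext_iff] using this
    have hxi : X i k ∈ Set.Ico 0 L := hX i k
    have hxj : X j k ∈ Set.Ico 0 L := hX j k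
    have hpi : 0 ≤ 2 * X i k / a := by have := hxi.1; positivity
    have hpj : 0 ≤ 2 * X j k / a := by have := hxj.1; positivity
    have h1 := Nat.floor_le hpi
    have h2 := Nat.lt_floor_add_one (2 * X i k / a)
    have h3 := Nat.floor_le hpj
    have h4 := Nat.lt_floor_add_one (2 * X j k / a)
    rw [hk] at h1 h2
    have hlt : |2 * X i k / a - 2 * X j k / a| < 1 := by
      rw [abs_sub_lt_iff]; constructor <;> linarith
    rw [Real.dist_eq]
    have hrew : X i k - X j k = (a / 2) * (2 * X i k / a - 2 * X j k / a) := by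
      field_simp
    rw [hrew, abs_mul, abs_of_pos (by positivity : (0 : ℝ) < a / 2)]
    calc a / 2 * |2 * X i k / a - 2 * X j k / a| < a / 2 * 1 :=
          mul_lt_mul_of_pos_left hlt (by positivity)
      _ = a / 2 := mul_one _
  rw [EuclideanSpace.dist_eq, Real.sqrt_lt' ha]
  calc ∑ k, dist (X i k) (X j k) ^ 2 < ∑ _k : Fin 3, (a / 2) ^ 2 :=
        Finset.sum_lt_sum_of_nonempty Finset.univ_nonempty fun k _ =>
          pow_lt_pow_left₀ (hcoord k) dist_nonneg two_ne_zero
    _ = 3 * (a / 2) ^ 2 := by simp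
    _ < a ^ 2 := by nlinarith

/-- **Too many hard spheres do not fit on the torus**: if `N > ⌈2L/a⌉³`, every periodic trial
state has infinite periodic energy for `hardCorePotential a`. [folklore] -/
theorem periodicEnergy_hardCorePotential_eq_top {a : ℝ} (ha : 0 < a) {L : ℝ} {N : ℕ}
    (hN : ⌈2 * L / a⌉₊ ^ 3 < N) (Ψ : PeriodicTrialState N L) :
    periodicEnergy (hardCorePotential a) Ψ = ⊤ := by
  have hpt : ∀ X ∈ cellN N L, ⊤ * ((‖Ψ.ψ X‖₊ : ℝ≥0∞) ^ 2) ≤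
      kineticDensity Ψ.ψ X +
        periodicInteraction (hardCorePotential a) L X * (‖Ψ.ψ X‖₊ : ℝ≥0∞) ^ 2 := by
    intro X hX
    obtain ⟨i, j, hij, hd⟩ := exists_dist_lt_of_ceil_pow_lt_of_mem_cellN ha hN hX
    have htop : periodicInteraction (hardCorePotential a) L X = ⊤ := by
      refine eq_top_iff.2 ?_
      calc (⊤ : ℝ≥0∞) = interaction (hardCorePotential a) X :=
            (interaction_eq_top_of_apply_eq_top hij (hardCorePotential_of_lt hd)).symm
        _ ≤ periodicInteraction (hardCorePotential a) L X := interaction_le_periodicInteraction _ L X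
    rw [htop]
    exact le_add_self
  have h1 : ∫⁻ X in cellN N L, ⊤ * ((‖Ψ.ψ X‖₊ : ℝ≥0∞) ^ 2) = ⊤ := by
    rw [lintegral_const_mul _ (measurable_ennnormSq Ψ.contDiff.continuous), Ψ.norm_eq, mul_one]
  rw [periodicEnergy, eq_top_iff, ← h1]
  exact setLIntegral_mono' (measurableSet_cellN N L) hpt

/-- Hence `E₀^per(N, L) = ⊤` for the hard-sphere gas as soon as `N > ⌈2L/a⌉³`. [folklore] -/
theorem periodicGroundStateEnergy_hardCorePotential_eq_top {a : ℝ} (ha : 0 < a) {L : ℝ} {N : ℕ}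
    (hN : ⌈2 * L / a⌉₊ ^ 3 < N) :
    periodicGroundStateEnergy (hardCorePotential a) N L = ⊤ := by
  rw [periodicGroundStateEnergy, iInf_eq_top]
  exact fun Ψ => periodicEnergy_hardCorePotential_eq_top ha hN Ψ

/-- Above `8/a³` the periodic hard-sphere ground-state energy on the thermodynamic torus is
eventually `⊤`. [folklore] -/
theorem eventually_periodicGroundStateEnergy_hardCorePotential_eq_top {a : ℝ} (ha : 0 < a)
    {ρ : ℝ} (hρ : 8 / a ^ 3 < ρ) :
    ∀ᶠ N : ℕ in atTop,
      periodicGroundStateEnergy (hardCorePotential a) N (sideLength ρ N) = ⊤ := by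
  filter_upwards [eventually_ceil_sideLength_pow_lt ha hρ] with N hN
  exact periodicGroundStateEnergy_hardCorePotential_eq_top ha hN

/-- **TIGHTNESS of the quantifier order `∀ v ∃ ρ₀`**: any density threshold witnessing
`ConsequentAt (hardCorePotential a)` is `≤ 8/a³`. [folklore] -/
theorem threshold_le_of_consequentAt_hardCorePotential {a : ℝ} (ha : 0 < a) {ρ₀ : ℝ}
    (h : ∀ ρ : ℝ, 0 < ρ → ρ < ρ₀ → ∃ c : ℝ, 0 < c ∧ ∀ᶠ N : ℕ in atTop,
      ∃ δ : ℝ≥0∞, 0 < δ ∧ ∀ Ψ : PeriodicTrialState N (sideLength ρ N),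
        periodicEnergy (hardCorePotential a) Ψ ≤
            periodicGroundStateEnergy (hardCorePotential a) N (sideLength ρ N) + δ →
          ENNReal.ofReal (c * N) ≤ condensateOccupation N (sideLength ρ N) Ψ.ψ) :
    ρ₀ ≤ 8 / a ^ 3 := by
  by_contra hlt
  push Not at hlt
  set ρ : ℝ := (8 / a ^ 3 + ρ₀) / 2 with hρdef
  have h8 : (0 : ℝ) < 8 / a ^ 3 := by positivity
  have hρ8 : 8 / a ^ 3 < ρ := by rw [hρdef]; linarith
  have hρ0 : 0 < ρ := h8.trans hρ8
  have hρρ₀ : ρ < ρ₀ := by rw [hρdef]; linarith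
  obtain ⟨c, hc, hev⟩ := h ρ hρ0 hρρ₀
  obtain ⟨N, ⟨δ, hδ, hΨ⟩, htop, hN2⟩ :=
    (hev.and ((eventually_periodicGroundStateEnergy_hardCorePotential_eq_top ha hρ8).and
      (eventually_ge_atTop 2))).exists
  have hNpos : 0 < N := by omega
  have hL : 0 < sideLength ρ N := sideLength_pos_of_pos hρ0 hNpos
  obtain ⟨m, hm⟩ := exists_nat_gt (1 / c)
  have hmpos : 0 < m := by
    have : (0 : ℝ) < m := (by positivity : (0 : ℝ) < 1 / c).trans hm
    exact_mod_cast this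
  obtain ⟨Φ, -, -, hocc⟩ := exists_fragmented_periodicTrialState (L := sideLength ρ N) hmpos hN2 hL
  have hwin : periodicEnergy (hardCorePotential a) Φ ≤
      periodicGroundStateEnergy (hardCorePotential a) N (sideLength ρ N) + δ := by
    rw [htop, top_add]; exact le_top
  have hcm : c ≤ 1 / m ^ 3 := le_inv_pow_of_ofReal_mul_le hNpos hmpos ((hΨ Φ hwin).trans hocc)
  have hm1 : (1 : ℝ) ≤ m := by exact_mod_cast hmpos
  have hmc : 1 / (m : ℝ) < c := by
    rw [div_lt_iff₀ (by positivity)]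
    rw [div_lt_iff₀ hc] at hm
    linarith
  have : 1 / (m : ℝ) ^ 3 ≤ 1 / (m : ℝ) := by
    apply div_le_div_of_nonneg_left zero_le_one (by positivity)
    calc (m : ℝ) = m ^ 1 := (pow_one _).symm
      _ ≤ m ^ 3 := pow_le_pow_right₀ hm1 (by norm_num)
  linarith

/-- Consequently the consequent is NOT witnessed by `ρ₀ = ⊤`-type thresholds: for hard spheres it
fails at every density above `8/a³` (formal shadow of crystallisation / close packing).
[folklore] -/
theorem consequentAt_hardCorePotential_threshold {a : ℝ} (ha : 0 < a) {ρ₀ : ℝ}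
    (h : ∀ ρ : ℝ, 0 < ρ → ρ < ρ₀ → ∃ c : ℝ, 0 < c ∧ ∀ᶠ N : ℕ in atTop,
      ∃ δ : ℝ≥0∞, 0 < δ ∧ ∀ Ψ : PeriodicTrialState N (sideLength ρ N),
        periodicEnergy (hardCorePotential a) Ψ ≤
            periodicGroundStateEnergy (hardCorePotential a) N (sideLength ρ N) + δ →
          ENNReal.ofReal (c * N) ≤ condensateOccupation N (sideLength ρ N) Ψ.ψ) :
    ρ₀ * a ^ 3 ≤ 8 := by
  have := threshold_le_of_consequentAt_hardCorePotential ha h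
  have ha3 : 0 < a ^ 3 := by positivity
  calc ρ₀ * a ^ 3 ≤ 8 / a ^ 3 * a ^ 3 := mul_le_mul_of_nonneg_right this ha3.le
    _ = 8 := div_mul_cancel₀ _ ha3.ne'

/-- The consequent's body with the density threshold chosen BEFORE the potential. [folklore] -/
def UniformConsequent : Prop :=
  ∃ ρ₀ : ℝ, 0 < ρ₀ ∧ ∀ v : ℝ → ℝ≥0∞, IsRepulsiveFiniteRange v →
    ∀ ρ : ℝ, 0 < ρ → ρ < ρ₀ → ∃ c : ℝ, 0 < c ∧ ∀ᶠ N : ℕ in atTop,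
      ∃ δ : ℝ≥0∞, 0 < δ ∧ ∀ Ψ : PeriodicTrialState N (sideLength ρ N),
        periodicEnergy v Ψ ≤ periodicGroundStateEnergy v N (sideLength ρ N) + δ →
          ENNReal.ofReal (c * N) ≤ condensateOccupation N (sideLength ρ N) Ψ.ψ

/-- `UniformConsequent` trivially implies the consequent (it is a strengthening). [folklore] -/
theorem periodicBEC_of_uniformConsequent (h : UniformConsequent) :
    BECPeriodicReduction.PeriodicBEC := by
  obtain ⟨ρ₀, hρ₀, hρ⟩ := h
  exact fun v hv => ⟨ρ₀, hρ₀, hρ v hv⟩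

/-- **No `v`-uniform density threshold** (refuted natural strengthening): hard spheres of radius
`a = (128/ρ₀)^{1/3}` (`8/a³ = ρ₀/16`) are the witness. [folklore] -/
theorem not_uniformConsequent : ¬ UniformConsequent := by
  rintro ⟨ρ₀, hρ₀, h⟩
  set a : ℝ := sideLength (ρ₀ / 2) 64 with hadef
  have hρ2 : 0 < ρ₀ / 2 := by positivity
  have ha : 0 < a := sideLength_pos_of_pos hρ2 (by norm_num)
  have ha3 : a ^ 3 = 64 / (ρ₀ / 2) := by
    rw [hadef, sideLength_pow_three hρ2]; norm_num
  have hle := threshold_le_of_consequentAt_hardCorePotential ha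
    (h (hardCorePotential a) (isRepulsiveFiniteRange_hardCorePotential a))
  rw [ha3] at hle
  have : (8 : ℝ) / (64 / (ρ₀ / 2)) = ρ₀ / 16 := by field_simp; ring
  rw [this] at hle
  linarith

/-- The bridge with a uniform-threshold consequent. [folklore] -/
def BridgeUniform : Prop :=
  KineticLatticeBEC → UniformConsequent

/-- **Uniform-threshold bridge ↔ ¬(lattice target)** — same fate as every windowed bridge (§4).
[folklore] -/
theorem bridgeUniform_iff_not_kinetic : BridgeUniform ↔ ¬ KineticLatticeBEC :=
  ⟨fun h hA => not_uniformConsequent (h hA), fun h hA => absurd hA h⟩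

/-- … while formally stronger than the crux. [folklore] -/
theorem crux_of_bridgeUniform (h : BridgeUniform) : LatticeToPeriodicBridge :=
  fun hA => periodicBEC_of_uniformConsequent (h hA)

/-! ## §8 The round-1 idea cards: first lemmas under attack (gen 2)

Three crux-ideate cards exist (`Ideas/coarse-cell-lorentzian.md` + `IdeatorSketch1.lean`;
`Ideas/coarse-cell-hardcore-floor.md` + `IdeatorSketch2.lean`;
`Ideas/muffin-tin-reward-supermodularity.md`, sketch attached as item evidence only). None of their
typed statements is a route item; they are the NATURAL STRENGTHENINGS / sub-bets a refuter can hit.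

### §8a `coarse-cell-lorentzian`: `TwoBodyCellLorentzian` is false as typed (v = 0)

The card's First lemma (restated verbatim below as `CardTwoBodyCellLorentzian`, so that this file
does not depend on the sketch module) asks, for EVERY admissible `v`, for a cell size `b₀` such that
for all `b ≥ b₀`, all `M ≥ 2` and some `δ > 0`, every REAL NON-NEGATIVE `δ`-near-minimiser of the
periodic two-body energy on the torus of side `M b` has a Lorentzian cell-pair kernel
`K(x,y) = ∫_{C_x × C_y} Re Ψ` in the reverse Cauchy–Schwarz form `(ΣK)(uᵀKu) ≤ (𝟙ᵀKu)²`.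

WITNESS at `v = 0` (`IsRepulsiveFiniteRange 0`; `E₀^per = 0`): `M = 2`, `L = 2b`, and for
`0 < ε ≤ 1`
  `Ψ_ε(ξ, η) = c_ε (1 + ε sin(2πξ₁/L) sin(2πη₁/L))`
(`C^∞`, `Lℤ³`-periodic in both particles, symmetric, real, `≥ 0`, normalised by `c_ε > 0`). Its
energy is `c_ε² ε² (2π/L)² ∫ (cos²sin² + sin²cos²) = O(ε²) → 0`, so for every `δ > 0` some `Ψ_ε` is
a `δ`-near-minimiser. Its kernel: `∫_{[0,b)} sin(πt/b) dt = 2b/π = -∫_{[b,2b)} sin(πt/b) dt`, hence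
  `K(x,y) = c_ε b⁶ (1 + (4ε/π²) s(x) s(y))`,  `s(x) = (-1)^{x₁} ∈ {±1}`, `Σ_x s(x) = 0`,
i.e. `K = c_ε b⁶ (𝟙𝟙ᵀ + (4ε/π²) s sᵀ)` has TWO positive eigenvalues (`64 c_ε b⁶` on `𝟙`,
`64 c_ε b⁶ · 4ε/π²` on `s ⟂ 𝟙`). With `u = s`: `𝟙ᵀKu = 0`, `uᵀKu = 64·(4ε/π²) c_ε b⁶ > 0`,
`ΣK = 64 c_ε b⁶ > 0`, so `(ΣK)(uᵀKu) > 0 = (𝟙ᵀKu)²` — the reverse Cauchy–Schwarz inequality FAILS,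
for every `b > 0` (so for every `b₀`) and every `δ > 0`. The finite-dimensional core — Lorentz
signature is NOT an open condition at the rank-one (free) kernel, where `λ₂ = 0` — is
`reverseCauchySchwarz_fails_near_flat` below; the continuum statement is PROVED
(`not_cardTwoBodyCellLorentzian`, via `not_twoBodyCellLorentzian`) with the bump variant
`Ψ_ε = k_ε(1 + ε|Θ_per(ξ,η)|²)`, `Θ` supported in `C₀ × C₀`, whose kernel
`k_ε(b⁶ + ε[x = y = 0])` needs only `vol(C_x × C_y) = b⁶` and `‖Θ‖₂ = 1`
(`bumpKernel_not_lorentzian`, `u = e_0 - e_1`).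

CLASSIFICATION: misstated. Repairs, either of which the witness MISSES: (i) add Fournais's standing
hypothesis `0 < scatteringLength v` (then at `M = 2` the exact kernel is a `(ℤ/2)³`-circulant
`K(x,y) = κ(x - y)` whose non-trivial characters have eigenvalues
`-Σ_z (-1)^{q·z} W(z) < 0`, `W(z) = ∫_{C_0×C_z} w_L(ξ-η)` decreasing in the number of non-zero
coordinates of `z` because the periodised scattering correction `w_L ≈ a/|r|` is radially
decreasing — strict signature, hence open, hence `δ(v,b,M) > 0` exists); (ii) state it for the
EXACT minimiser, as the card's general `PairCellLorentzian` already does (at `v = 0` the exact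
minimiser is constant, `K` rank one, equality). LESSON for the line: `a(v) > 0` is load-bearing at
`N = 2` already, and the admissible slack is `δ ≲ λ₂-margin ≍ a b⁵ c_ε`, i.e. `δ → 0` as `a → 0` —
the near-minimiser robustness the assembly needs (`IntegratedPairCoherence`) must come from the
factor-2 slack of the INTEGRATED inequality at the flat kernel (`ΣK² = 64k² < 128k² = RHS`), not
from openness of signature. `IntegratedPairCoherence` itself survives `v = 0` for that reason; note
however that it is NOT a universal inequality for entrywise non-negative kernels (`K = I₃`:
`‖K‖² = 3 > 2 = Σr³/R + ‖r‖⁴/R²`), so "paired-in-cell" kernels are exactly what it forbids. -/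

/-- Finite-dimensional core of §8a: arbitrarily close to the flat (rank-one, free-gas) kernel there
are entrywise-POSITIVE symmetric kernels violating the reverse Cauchy–Schwarz (Lorentzian)
inequality — `K_ε = 𝟙𝟙ᵀ + ε s sᵀ` on two cells, `s = (1,-1)`, test vector `u = s`:
`(ΣK)(uᵀKu) = 4 · 4ε > 0 = (𝟙ᵀKu)²`. Lorentz signature is not an open condition at `λ₂ = 0`.
[folklore] -/
theorem reverseCauchySchwarz_fails_near_flat {ε : ℝ} (hε : 0 < ε) :
    let s : Fin 2 → ℝ := ![1, -1]
    let K : Fin 2 → Fin 2 → ℝ := fun x y => 1 + ε * s x * s y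
    (∀ x y, 0 < K x y ∨ ε ≥ 1) ∧
      (∑ x, ∑ y, K x y * s y) ^ 2 < (∑ x, ∑ y, K x y) * (∑ x, ∑ y, s x * K x y * s y) := by
  refine ⟨?_, ?_⟩
  · intro x y
    by_cases h1 : ε ≥ 1
    · exact Or.inr h1
    · left
      push Not at h1
      fin_cases x <;> fin_cases y <;> simp <;> nlinarith
  · simp [Fin.sum_univ_two]
    nlinarith

/-- The same on the witness's actual cell set `(Fin 3 → Fin 2)` (8 cells, `M = 2`), with
`s(x) = (-1)^{x 0}`: for the kernel `K(x,y) = k (1 + t s(x) s(y))`, `k > 0`, `t > 0` (the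
`v = 0` witness has `k = c_ε b⁶`, `t = 4ε/π²`), the reverse Cauchy–Schwarz inequality fails at
`u = s`. [folklore] -/
theorem reverseCauchySchwarz_fails_eightCells {k t : ℝ} (hk : 0 < k) (ht : 0 < t) :
    let s : (Fin 3 → Fin 2) → ℝ := fun x => if x 0 = 0 then 1 else -1
    let K : (Fin 3 → Fin 2) → (Fin 3 → Fin 2) → ℝ := fun x y => k * (1 + t * s x * s y)
    (∑ x, ∑ y, K x y * s y) ^ 2 < (∑ x, ∑ y, K x y) * (∑ x, ∑ y, s x * K x y * s y) := by
  intro s K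
  -- the sign vector is balanced and squares to one
  have hs2 : ∀ x, s x * s x = 1 := by
    intro x; by_cases h : x 0 = 0 <;> simp [s, h]
  have hsum : ∑ x : Fin 3 → Fin 2, s x = 0 := by
    -- pair `x` with the flip of its first coordinate
    let φ : (Fin 3 → Fin 2) → (Fin 3 → Fin 2) := fun x => Function.update x 0 (x 0 + 1)
    have hφs : ∀ x, s (φ x) = - s x := by
      intro x
      have hx : (φ x) 0 = x 0 + 1 := by simp [φ]
      by_cases h : x 0 = 0
      · have : (φ x) 0 ≠ 0 := by rw [hx, h]; decide
        simp [s, h, this]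
      · have h1 : x 0 = 1 := by omega
        have : (φ x) 0 = 0 := by rw [hx, h1]; decide
        simp [s, h, this]
    have hφ : Function.Bijective φ := by
      have hinv : Function.Involutive φ := by
        intro x
        ext i
        by_cases hi : i = 0
        · subst hi
          simp [φ]
          have : ((x 0 + 1 + 1 : Fin 2) : ℕ) = (x 0 : ℕ) := by omega
          exact_mod_cast this
        · simp [φ, hi]
      exact hinv.bijective
    have h1 : ∑ x, s (φ x) = ∑ x, s x :=
      Function.Bijective.sum_comp hφ s
    have h2 : ∑ x, s (φ x) = - ∑ x, s x := by
      rw [← Finset.sum_neg_distrib]; exact Finset.sum_congr rfl fun x _ => hφs x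
    linarith
  have hcard : (Finset.univ : Finset (Fin 3 → Fin 2)).card = 8 := by simp
  have hconst : ∀ c : ℝ, ∑ _y : Fin 3 → Fin 2, c = 8 * c := by
    intro c; rw [Finset.sum_const, hcard, nsmul_eq_mul]; push_cast; ring
  -- pointwise closed forms
  have e1 : ∀ x y, K x y * s y = k * s y + k * t * s x := by
    intro x y; have h := hs2 y; simp only [K]; linear_combination (k * t * s x) * h
  have e2 : ∀ x y, K x y = k + k * t * s x * s y := by
    intro x y; simp only [K]; ring
  have e3 : ∀ x y, s x * K x y * s y = k * s x * s y + k * t := by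
    intro x y; have hx := hs2 x; have hy := hs2 y; simp only [K]
    linear_combination (k * t) * hx * (s y * s y) + (k * t) * hy
  -- the three sums
  have hA : ∑ x, ∑ y, K x y * s y = 0 := by
    have hx : ∀ x, ∑ y, K x y * s y = 8 * (k * t) * s x := by
      intro x
      calc ∑ y, K x y * s y = ∑ y, (k * s y + k * t * s x) := Finset.sum_congr rfl fun y _ => e1 x y
        _ = k * ∑ y, s y + ∑ _y : Fin 3 → Fin 2, k * t * s x := by
            rw [Finset.sum_add_distrib, Finset.mul_sum]
        _ = 8 * (k * t) * s x := by rw [hsum, hconst]; ring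
    calc ∑ x, ∑ y, K x y * s y = ∑ x, 8 * (k * t) * s x := Finset.sum_congr rfl fun x _ => hx x
      _ = 8 * (k * t) * ∑ x, s x := by rw [Finset.mul_sum]
      _ = 0 := by rw [hsum, mul_zero]
  have hB : ∑ x, ∑ y, K x y = 64 * k := by
    have hx : ∀ x, ∑ y, K x y = 8 * k := by
      intro x
      calc ∑ y, K x y = ∑ y, (k + k * t * s x * s y) := Finset.sum_congr rfl fun y _ => e2 x y
        _ = (∑ _y : Fin 3 → Fin 2, k) + k * t * s x * ∑ y, s y := by
            rw [Finset.sum_add_distrib, Finset.mul_sum]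
        _ = 8 * k := by rw [hsum, hconst]; ring
    calc ∑ x, ∑ y, K x y = ∑ _x : Fin 3 → Fin 2, 8 * k := Finset.sum_congr rfl fun x _ => hx x
      _ = 64 * k := by rw [hconst]; ring
  have hC : ∑ x, ∑ y, s x * K x y * s y = 64 * (k * t) := by
    have hx : ∀ x, ∑ y, s x * K x y * s y = 8 * (k * t) := by
      intro x
      calc ∑ y, s x * K x y * s y = ∑ y, (k * s x * s y + k * t) :=
            Finset.sum_congr rfl fun y _ => e3 x y
        _ = k * s x * ∑ y, s y + ∑ _y : Fin 3 → Fin 2, k * t := by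
            rw [Finset.sum_add_distrib, Finset.mul_sum]
        _ = 8 * (k * t) := by rw [hsum, hconst]; ring
    calc ∑ x, ∑ y, s x * K x y * s y = ∑ _x : Fin 3 → Fin 2, 8 * (k * t) :=
          Finset.sum_congr rfl fun x _ => hx x
      _ = 64 * (k * t) := by rw [hconst]; ring
  rw [hA, hB, hC]
  nlinarith [mul_pos hk hk, mul_pos (mul_pos hk hk) ht]

/-! ### §8a (continued) — the `v = 0` witness, fully formalised (gen 2; mirrored in `Negative/TwoBodyWitness.lean` + `Negative/TwoBodyCellLorentzian.lean`, proposals pending)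

#### The finite-dimensional core: a "paired-in-one-cell" bump on a flat kernel is not Lorentzian -/

/-- For a flat kernel `P > 0` plus a bump `Q > 0` concentrated on one diagonal cell pair `(a,a)`,
the reverse Cauchy–Schwarz (Lorentzian) inequality fails at `u = e_a - e_z`, `z ≠ a`:
`(ΣKu)² = Q² < (n²P + Q)·Q = (ΣK)(uᵀKu)`. [folklore] -/
theorem bumpKernel_not_lorentzian {ι : Type*} [Fintype ι] [DecidableEq ι] {a z : ι} (haz : a ≠ z)
    {P Q : ℝ} (hP : 0 < P) (hQ : 0 < Q) :
    let K : ι → ι → ℝ := fun x y => P + if x = a ∧ y = a then Q else 0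
    let u : ι → ℝ := fun x => (if x = a then 1 else 0) - if x = z then 1 else 0
    (∑ x, ∑ y, K x y * u y) ^ 2 < (∑ x, ∑ y, K x y) * (∑ x, ∑ y, u x * K x y * u y) := by
  intro K u
  have hza : z ≠ a := fun h => haz h.symm
  -- Σ_y u y = 0
  have hu : ∑ y, u y = 0 := by
    simp only [u, Finset.sum_sub_distrib, Finset.sum_ite_eq', Finset.mem_univ, if_true, sub_self]
  -- row sums against u
  have hrow : ∀ x, ∑ y, K x y * u y = if x = a then Q else 0 := by
    intro x
    have : ∀ y, K x y * u y = P * u y + (if x = a ∧ y = a then Q else 0) * u y := by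
      intro y; simp only [K]; ring
    simp_rw [this, Finset.sum_add_distrib, ← Finset.mul_sum, hu, mul_zero, zero_add]
    by_cases hx : x = a
    · simp only [hx, true_and, if_true]
      rw [Finset.sum_eq_single a]
      · simp [u, haz]
      · intro y _ hy; simp [hy]
      · intro h; exact absurd (Finset.mem_univ a) h
    · simp [hx]
  have hA : ∑ x, ∑ y, K x y * u y = Q := by
    simp_rw [hrow, Finset.sum_ite_eq', Finset.mem_univ, if_true]
  have hC : ∑ x, ∑ y, u x * K x y * u y = Q := by
    have : ∀ x, ∑ y, u x * K x y * u y = u x * ∑ y, K x y * u y := by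
      intro x; rw [Finset.mul_sum]; refine Finset.sum_congr rfl fun y _ => ?_; ring
    simp_rw [this, hrow]
    rw [Finset.sum_eq_single a]
    · simp [u, haz]
    · intro x _ hx; simp [hx]
    · intro h; exact absurd (Finset.mem_univ a) h
  have hB : ∑ x, ∑ y, K x y = (Fintype.card ι : ℝ) ^ 2 * P + Q := by
    have hrowK : ∀ x, ∑ y, K x y = (Fintype.card ι : ℝ) * P + if x = a then Q else 0 := by
      intro x
      simp only [K, Finset.sum_add_distrib, Finset.sum_const, Finset.card_univ, nsmul_eq_mul]
      congr 1
      by_cases hx : x = a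
      · simp only [hx, true_and, Finset.sum_ite_eq', Finset.mem_univ, if_true]
      · simp [hx]
    simp_rw [hrowK, Finset.sum_add_distrib, Finset.sum_const, Finset.card_univ, nsmul_eq_mul,
      Finset.sum_ite_eq', Finset.mem_univ, if_true]
    ring
  rw [hA, hB, hC]
  have hcard : (1 : ℝ) ≤ Fintype.card ι := by
    have : 0 < Fintype.card ι := Fintype.card_pos_iff.2 ⟨a⟩
    exact_mod_cast this
  have hc2 : (1 : ℝ) ≤ (Fintype.card ι : ℝ) ^ 2 := by nlinarith [hcard]
  have hPQ : 0 < P * Q := mul_pos hP hQ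
  nlinarith [mul_le_mul_of_nonneg_right hc2 hPQ.le, hPQ]

/-! #### A two-body Dirichlet product state living in the first half-cell -/

/-- Two particles in the unit bump of block `0` of the side-`4` box: a Dirichlet trial state whose
wave function is supported in `(1/2, 3/2)³ × (1/2, 3/2)³`. [folklore] -/
def blockPair : TrialState 2 (2 * ((2 : ℕ) : ℝ)) :=
  ((blockState 2 2 (0 : Block 2)).mono fun _ hx => blockSet_subset_box 2 hx).toTrialState

theorem blockPair_ψ (X : Config 2) :
    blockPair.ψ X = (blockState 2 2 (0 : Block 2)).ψ X := rfl

theorem blockPair_ψ_eq : blockPair.ψ = (blockState 2 2 (0 : Block 2)).ψ := rfl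

/-- Where `blockPair` is non-zero, every coordinate lies in `(1/2, 3/2)`. [folklore] -/
theorem blockPair_support {X : Config 2} (h : blockPair.ψ X ≠ 0) (i : Fin 2) (k : Fin 3) :
    1 / 2 < X i k ∧ X i k < 3 / 2 := by
  have hm := mem_blockSet_of_blockState_ne_zero (by rwa [blockPair_ψ] at h) i
  have := (mem_blockSet 2).1 hm k
  simp only [Pi.zero_apply, Fin.val_zero, CharP.cast_eq_zero, mul_zero, zero_add] at this
  exact this

/-- The free energy of `blockPair` is `2 𝓔₀[β] < ⊤`. [folklore] -/
theorem energy_blockPair : energy 0 blockPair = 2 * energy 0 unitBump := by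
  rw [energy_eq_rawEnergy]
  have h := rawEnergy_zero_blockState (N := 2) (m := 2) 0
  rw [blockPair_ψ_eq] ; exact_mod_cast h

theorem energy_blockPair_lt_top : energy 0 blockPair < ⊤ := by
  rw [energy_blockPair]
  exact ENNReal.mul_lt_top (by simp) energy_unitBump_lt_top

/-- The block pair dilated to the torus cell of side `L`: supported in `(L/8, 3L/8)⁶`. [folklore] -/
def dilatedPair {L : ℝ} (hL : 0 < L) : TrialState 2 L :=
  (blockPair.dilate (s := L / 4) (by positivity)).castLen (by push_cast; ring)

theorem dilatedPair_ψ {L : ℝ} (hL : 0 < L) (Y : Config 2) :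
    (dilatedPair hL).ψ Y =
      (Real.sqrt (((L / 4) ^ Module.finrank ℝ (Config 2))⁻¹) : ℂ) * blockPair.ψ ((L / 4)⁻¹ • Y) := by
  rw [dilatedPair, TrialState.castLen_ψ, TrialState.dilate_ψ]

/-- Support of the dilated pair. [folklore] -/
theorem dilatedPair_support {L : ℝ} (hL : 0 < L) {Y : Config 2} (h : (dilatedPair hL).ψ Y ≠ 0)
    (i : Fin 2) (k : Fin 3) : L / 8 < Y i k ∧ Y i k < 3 * L / 8 := by
  rw [dilatedPair_ψ] at h
  have h' : blockPair.ψ ((L / 4)⁻¹ • Y) ≠ 0 := fun h0 => h (by rw [h0, mul_zero])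
  have := blockPair_support h' i k
  simp only [Pi.smul_apply, PiLp.smul_apply, smul_eq_mul] at this
  have h4 : (0 : ℝ) < L / 4 := by positivity
  rw [← div_eq_inv_mul, lt_div_iff₀ h4, div_lt_iff₀ h4] at this
  constructor <;> linarith [this.1, this.2]

/-- Finite free energy of the dilated pair. [folklore] -/
theorem energy_dilatedPair_lt_top {L : ℝ} (hL : 0 < L) : energy 0 (dilatedPair hL) < ⊤ := by
  rw [dilatedPair, TrialState.energy_castLen]
  have h := TrialState.energy_dilate 0 blockPair (s := L / 4) (by positivity)
  rw [scalePotential_zero] at h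
  rw [h]
  exact ENNReal.mul_lt_top ENNReal.ofReal_lt_top energy_blockPair_lt_top

/-- The dilated pair is bounded (continuous with compact support). [folklore] -/
theorem hasCompactSupport_dilatedPair {L : ℝ} (hL : 0 < L) :
    HasCompactSupport (dilatedPair hL).ψ := by
    refine HasCompactSupport.intro (isCompact_closedBall (0 : Config 2) (3 * L)) fun Y hY => ?_
    by_contra h
    apply hY
    rw [Metric.mem_closedBall, dist_zero_right, pi_norm_le_iff_of_nonneg (by positivity)]
    intro i
    have hcoord := fun k => dilatedPair_support hL h i k
    rw [EuclideanSpace.norm_eq]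
    calc Real.sqrt (∑ k, ‖Y i k‖ ^ 2) ≤ Real.sqrt (∑ _k : Fin 3, L ^ 2) := by
          refine Real.sqrt_le_sqrt (Finset.sum_le_sum fun k _ => ?_)
          rw [Real.norm_eq_abs, sq_abs]
          have := hcoord k
          nlinarith [this.1, this.2, hL]
      _ ≤ Real.sqrt ((3 * L) ^ 2) := by
          refine Real.sqrt_le_sqrt ?_
          simp only [Finset.sum_const, Finset.card_univ, Fintype.card_fin, nsmul_eq_mul]
          push_cast
          nlinarith [hL]
      _ = 3 * L := Real.sqrt_sq (by positivity)

theorem exists_bound_dilatedPair {L : ℝ} (hL : 0 < L) :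
    ∃ S : ℝ, 0 ≤ S ∧ ∀ Y, ‖(dilatedPair hL).ψ Y‖ ≤ S := by
  obtain ⟨C, hC⟩ := (dilatedPair hL).contDiff.continuous.bounded_above_of_compact_support
    (hasCompactSupport_dilatedPair hL)
  exact ⟨max C 0, le_max_right _ _, fun Y => (hC Y).trans (le_max_left _ _)⟩

/-! #### The periodic witness `W_ε = 1 + ε |Θ_per|²` -/

section Witness

variable {L : ℝ}

/-- The dilated pair periodised on the torus of side `L`. [folklore] -/
def pairPer (hL : 0 < L) : PeriodicTrialState 2 L := (dilatedPair hL).toPeriodic hL le_rfl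

theorem pairPer_ψ (hL : 0 < L) (X : Config 2) :
    (pairPer hL).ψ X = periodize L (dilatedPair hL).ψ X := rfl

theorem pairPer_ψ_of_mem (hL : 0 < L) {X : Config 2} (hX : X ∈ cellN 2 L) :
    (pairPer hL).ψ X = (dilatedPair hL).ψ X :=
  periodize_of_mem_cellN hL _ hX

/-- A bound of the Dirichlet state bounds its periodisation (which only re-evaluates it). [folklore] -/
theorem norm_pairPer_le (hL : 0 < L) {S : ℝ} (hS : ∀ Y, ‖(dilatedPair hL).ψ Y‖ ≤ S) (X : Config 2) :
    ‖(pairPer hL).ψ X‖ ≤ S :=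
  hS _

/-- The periodised pair has finite free periodic energy. [folklore] -/
theorem periodicEnergy_pairPer_lt_top (hL : 0 < L) : periodicEnergy 0 (pairPer hL) < ⊤ :=
  lt_of_le_of_lt ((dilatedPair hL).periodicEnergy_toPeriodic_le (v := 0) (R₀ := 0)
    (fun _ _ => rfl) hL le_rfl (by linarith)) (energy_dilatedPair_lt_top hL)

/-- The (un-normalised) witness `W_ε(X) = 1 + ε |Θ_per(X)|²`, real and `≥ 1`. [folklore] -/
def witnessFun (hL : 0 < L) (ε : ℝ) (X : Config 2) : ℂ :=
  ((1 + ε * ‖(pairPer hL).ψ X‖ ^ 2 : ℝ) : ℂ)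

theorem witnessFun_re (hL : 0 < L) (ε : ℝ) (X : Config 2) :
    (witnessFun hL ε X).re = 1 + ε * ‖(pairPer hL).ψ X‖ ^ 2 :=
  rfl

theorem witnessFun_im (hL : 0 < L) (ε : ℝ) (X : Config 2) : (witnessFun hL ε X).im = 0 :=
  rfl

theorem one_le_witnessFun_re (hL : 0 < L) {ε : ℝ} (hε : 0 ≤ ε) (X : Config 2) :
    1 ≤ (witnessFun hL ε X).re := by
  rw [witnessFun_re]
  nlinarith [sq_nonneg ‖(pairPer hL).ψ X‖]

theorem norm_witnessFun (hL : 0 < L) {ε : ℝ} (hε : 0 ≤ ε) (X : Config 2) :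
    ‖witnessFun hL ε X‖ = 1 + ε * ‖(pairPer hL).ψ X‖ ^ 2 := by
  rw [witnessFun, Complex.norm_real, Real.norm_of_nonneg (by positivity)]

theorem one_le_norm_witnessFun (hL : 0 < L) {ε : ℝ} (hε : 0 ≤ ε) (X : Config 2) :
    1 ≤ ‖witnessFun hL ε X‖ := by
  rw [norm_witnessFun hL hε]; nlinarith [sq_nonneg ‖(pairPer hL).ψ X‖]

theorem norm_witnessFun_le (hL : 0 < L) {ε S : ℝ} (hε : 0 ≤ ε) (hS : ∀ Y, ‖(dilatedPair hL).ψ Y‖ ≤ S)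
    (X : Config 2) : ‖witnessFun hL ε X‖ ≤ 1 + ε * S ^ 2 := by
  rw [norm_witnessFun hL hε]
  have h := norm_pairPer_le hL hS X
  have h0 : 0 ≤ ‖(pairPer hL).ψ X‖ := norm_nonneg _
  nlinarith [mul_le_mul h h h0 (h0.trans h)]

theorem contDiff_witnessFun (hL : 0 < L) (ε : ℝ) : ContDiff ℝ 1 (witnessFun hL ε) := by
  unfold witnessFun
  exact Complex.ofRealCLM.contDiff.comp
    (contDiff_const.add (contDiff_const.mul ((pairPer hL).contDiff.norm_sq ℝ)))

theorem witnessFun_periodic (hL : 0 < L) (ε : ℝ) (X : Config 2) (i : Fin 2) (a : Fin 3) :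
    witnessFun hL ε (X + Pi.single i (EuclideanSpace.single a L)) = witnessFun hL ε X := by
  simp only [witnessFun, (pairPer hL).periodic]

theorem witnessFun_symm (hL : 0 < L) (ε : ℝ) (σ : Equiv.Perm (Fin 2)) (X : Config 2) :
    witnessFun hL ε (X ∘ σ) = witnessFun hL ε X := by
  simp only [witnessFun, (pairPer hL).symm]

/-- The `L²(cell)`-norm of the witness is at least the volume `L⁶`. [folklore] -/
theorem volume_le_lintegral_witnessFun (hL : 0 < L) {ε : ℝ} (hε : 0 ≤ ε) :
    (ENNReal.ofReal L ^ 3) ^ 2 ≤ ∫⁻ X in cellN 2 L, ((‖witnessFun hL ε X‖₊ : ℝ≥0∞)) ^ 2 := by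
  rw [← volume_cellN 2 L, ← setLIntegral_one]
  refine setLIntegral_mono' (measurableSet_cellN 2 L) fun X _ => ?_
  rw [coe_nnnorm_sq_eq_ofReal, ← ENNReal.ofReal_one]
  refine ENNReal.ofReal_le_ofReal ?_
  nlinarith [one_le_norm_witnessFun hL hε X]

/-- … and at most `(1 + εS²)² L⁶ < ⊤`. [folklore] -/
theorem lintegral_witnessFun_le (hL : 0 < L) {ε S : ℝ} (hε : 0 ≤ ε)
    (hS : ∀ Y, ‖(dilatedPair hL).ψ Y‖ ≤ S) :
    ∫⁻ X in cellN 2 L, ((‖witnessFun hL ε X‖₊ : ℝ≥0∞)) ^ 2 ≤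
      ENNReal.ofReal ((1 + ε * S ^ 2) ^ 2) * (ENNReal.ofReal L ^ 3) ^ 2 := by
  rw [← volume_cellN 2 L, ← setLIntegral_const]
  refine setLIntegral_mono' (measurableSet_cellN 2 L) fun X _ => ?_
  rw [coe_nnnorm_sq_eq_ofReal]
  exact ENNReal.ofReal_le_ofReal
    (pow_le_pow_left₀ (norm_nonneg _) (norm_witnessFun_le hL hε hS X) 2)

theorem lintegral_witnessFun_ne_zero (hL : 0 < L) {ε : ℝ} (hε : 0 ≤ ε) :
    ∫⁻ X in cellN 2 L, ((‖witnessFun hL ε X‖₊ : ℝ≥0∞)) ^ 2 ≠ 0 := by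
  have hpos : 0 < (ENNReal.ofReal L ^ 3) ^ 2 := by
    have : 0 < ENNReal.ofReal L := ENNReal.ofReal_pos.2 hL
    positivity
  exact (hpos.trans_le (volume_le_lintegral_witnessFun hL hε)).ne'

theorem lintegral_witnessFun_ne_top (hL : 0 < L) {ε : ℝ} (hε : 0 ≤ ε) :
    ∫⁻ X in cellN 2 L, ((‖witnessFun hL ε X‖₊ : ℝ≥0∞)) ^ 2 ≠ ⊤ := by
  obtain ⟨S, -, hS⟩ := exists_bound_dilatedPair hL
  exact ne_top_of_le_ne_top (ENNReal.mul_ne_top ENNReal.ofReal_ne_top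
    (ENNReal.pow_ne_top (ENNReal.pow_ne_top ENNReal.ofReal_ne_top))) (lintegral_witnessFun_le hL hε hS)

/-- The normalised witness state `Ψ_ε = W_ε / ‖W_ε‖`. [folklore] -/
def witness (hL : 0 < L) {ε : ℝ} (hε : 0 ≤ ε) : PeriodicTrialState 2 L :=
  PeriodicTrialState.ofFun (witnessFun hL ε) (contDiff_witnessFun hL ε) (witnessFun_periodic hL ε)
    (witnessFun_symm hL ε) (lintegral_witnessFun_ne_zero hL hε) (lintegral_witnessFun_ne_top hL hε)

/-- Its normalising constant `k_ε = ‖W_ε‖⁻¹`. [folklore] -/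
def witnessConst (hL : 0 < L) (ε : ℝ) : ℝ :=
  (Real.sqrt (∫⁻ X in cellN 2 L, ((‖witnessFun hL ε X‖₊ : ℝ≥0∞)) ^ 2).toReal)⁻¹

theorem witness_ψ (hL : 0 < L) {ε : ℝ} (hε : 0 ≤ ε) (X : Config 2) :
    (witness hL hε).ψ X = (witnessConst hL ε : ℂ) * witnessFun hL ε X := by
  unfold witness witnessConst
  rw [PeriodicTrialState.ofFun_apply, Complex.ofReal_inv]

theorem witness_ψ_eq (hL : 0 < L) {ε : ℝ} (hε : 0 ≤ ε) :
    (witness hL hε).ψ = fun X => (witnessConst hL ε : ℂ) * witnessFun hL ε X :=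
  funext (witness_ψ hL hε)

theorem witnessConst_pos (hL : 0 < L) {ε : ℝ} (hε : 0 ≤ ε) : 0 < witnessConst hL ε := by
  unfold witnessConst
  refine inv_pos.2 (Real.sqrt_pos.2 (ENNReal.toReal_pos (lintegral_witnessFun_ne_zero hL hε)
    (lintegral_witnessFun_ne_top hL hε)))

/-- `k_ε² ≤ L⁻⁶`. [folklore] -/
theorem witnessConst_sq_le (hL : 0 < L) {ε : ℝ} (hε : 0 ≤ ε) :
    witnessConst hL ε ^ 2 ≤ (L ^ 6)⁻¹ := by
  unfold witnessConst
  set I := ∫⁻ X in cellN 2 L, ((‖witnessFun hL ε X‖₊ : ℝ≥0∞)) ^ 2 with hI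
  have hItop : I ≠ ⊤ := lintegral_witnessFun_ne_top hL hε
  have hIpos : 0 < I.toReal := ENNReal.toReal_pos (lintegral_witnessFun_ne_zero hL hε) hItop
  have hL6 : L ^ 6 ≤ I.toReal := by
    have h := volume_le_lintegral_witnessFun hL hε
    rw [← hI] at h
    have h' : ((ENNReal.ofReal L ^ 3) ^ 2).toReal ≤ I.toReal := ENNReal.toReal_mono hItop h
    rwa [ENNReal.toReal_pow, ENNReal.toReal_pow, ENNReal.toReal_ofReal hL.le, ← pow_mul] at h'
  rw [inv_pow, Real.sq_sqrt hIpos.le]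
  exact inv_anti₀ (by positivity) hL6

/-- The witness is real and non-negative. [folklore] -/
theorem witness_real_nonneg (hL : 0 < L) {ε : ℝ} (hε : 0 ≤ ε) (X : Config 2) :
    0 ≤ ((witness hL hε).ψ X).re ∧ ((witness hL hε).ψ X).im = 0 := by
  rw [witness_ψ, Complex.mul_re, Complex.mul_im, witnessFun_im, Complex.ofReal_re,
    Complex.ofReal_im]
  refine ⟨?_, by ring⟩
  simp only [mul_zero, sub_zero]
  exact mul_nonneg (witnessConst_pos hL hε).le ((one_le_witnessFun_re hL hε X).trans' zero_le_one)

/-- `‖a‖ ≤ c ‖b‖` in squared `ℝ≥0∞` form. [folklore] -/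
theorem ennnorm_sq_le_of_norm_le {α β : Type*} [SeminormedAddCommGroup α] [SeminormedAddCommGroup β]
    {a : α} {b : β} {c : ℝ} (h : ‖a‖ ≤ c * ‖b‖) :
    ((‖a‖₊ : ℝ≥0∞)) ^ 2 ≤ ENNReal.ofReal (c ^ 2) * ((‖b‖₊ : ℝ≥0∞)) ^ 2 := by
  rw [coe_nnnorm_sq_eq_ofReal, coe_nnnorm_sq_eq_ofReal, ← ENNReal.ofReal_mul (sq_nonneg _)]
  refine ENNReal.ofReal_le_ofReal ?_
  calc ‖a‖ ^ 2 ≤ (c * ‖b‖) ^ 2 := pow_le_pow_left₀ (norm_nonneg _) h 2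
    _ = c ^ 2 * ‖b‖ ^ 2 := by ring

/-- **Product-rule bound**: `|∇W_ε|² ≤ (2εS)² |∇Θ_per|²` pointwise. [folklore] -/
theorem kineticDensity_witnessFun_le (hL : 0 < L) {ε S : ℝ} (hε : 0 ≤ ε)
    (hS : ∀ Y, ‖(dilatedPair hL).ψ Y‖ ≤ S) (X : Config 2) :
    kineticDensity (witnessFun hL ε) X ≤
      ENNReal.ofReal ((2 * ε * S) ^ 2) * kineticDensity (pairPer hL).ψ X := by
  set f : Config 2 → ℂ := (pairPer hL).ψ with hf
  have hdf : HasFDerivAt f (fderiv ℝ f X) X :=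
    (((pairPer hL).contDiff.differentiable one_ne_zero) X).hasFDerivAt
  have hg : HasFDerivAt (fun Y => ‖f Y‖ ^ 2) (2 • (innerSL ℝ (f X)).comp (fderiv ℝ f X)) X :=
    hdf.norm_sq
  have h1 : HasFDerivAt (fun Y => (1 : ℝ) + ε * ‖f Y‖ ^ 2)
      (ε • (2 • (innerSL ℝ (f X)).comp (fderiv ℝ f X))) X :=
    (hg.const_mul ε).const_add 1
  have hw : HasFDerivAt (witnessFun hL ε)
      (Complex.ofRealCLM.comp (ε • (2 • (innerSL ℝ (f X)).comp (fderiv ℝ f X)))) X :=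
    Complex.ofRealCLM.hasFDerivAt.comp X h1
  unfold kineticDensity
  rw [hw.fderiv, Finset.mul_sum]
  refine Finset.sum_le_sum fun i _ => ?_
  rw [Finset.mul_sum]
  refine Finset.sum_le_sum fun k _ => ?_
  refine ennnorm_sq_le_of_norm_le ?_
  set v : Config 2 := Pi.single i (EuclideanSpace.single k (1 : ℝ))
  have hin : |@inner ℝ ℂ _ (f X) (fderiv ℝ f X v)| ≤ ‖f X‖ * ‖fderiv ℝ f X v‖ :=
    abs_real_inner_le_norm _ _
  have hfX : ‖f X‖ ≤ S := norm_pairPer_le hL hS X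
  have happ : (Complex.ofRealCLM.comp (ε • (2 • (innerSL ℝ (f X)).comp (fderiv ℝ f X)))) v =
      ((ε * (2 * @inner ℝ ℂ _ (f X) (fderiv ℝ f X v)) : ℝ) : ℂ) := by
    simp only [ContinuousLinearMap.comp_apply, smul_apply, innerSL_apply_apply,
      Complex.ofRealCLM_apply, smul_eq_mul, nsmul_eq_mul, Nat.cast_ofNat]
  rw [happ, Complex.norm_real, Real.norm_eq_abs, abs_mul, abs_mul, abs_of_nonneg hε, abs_two]
  calc ε * (2 * |@inner ℝ ℂ _ (f X) (fderiv ℝ f X v)|) ≤ ε * (2 * (S * ‖fderiv ℝ f X v‖)) := by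
        gcongr
        exact hin.trans (mul_le_mul_of_nonneg_right hfX (norm_nonneg _))
    _ = 2 * ε * S * ‖fderiv ℝ f X v‖ := by ring

/-- `v = 0`: the periodic interaction vanishes. [folklore] -/
theorem periodicInteraction_zero' (L : ℝ) (X : Config 2) : periodicInteraction 0 L X = 0 := by
  simp [periodicInteraction, periodizedPotential]

/-- **Energy of the witness**: `𝓔^per_0[Ψ_ε] ≤ k_ε² (2εS)² 𝓔^per_0[Θ_per]`. [folklore] -/
theorem periodicEnergy_witness_le (hL : 0 < L) {ε S : ℝ} (hε : 0 ≤ ε)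
    (hS : ∀ Y, ‖(dilatedPair hL).ψ Y‖ ≤ S) :
    periodicEnergy 0 (witness hL hε) ≤
      ENNReal.ofReal (witnessConst hL ε ^ 2) * ENNReal.ofReal ((2 * ε * S) ^ 2) *
        periodicEnergy 0 (pairPer hL) := by
  have hk0 : 0 ≤ witnessConst hL ε := (witnessConst_pos hL hε).le
  unfold periodicEnergy
  simp only [periodicInteraction_zero', zero_mul, add_zero]
  calc ∫⁻ X in cellN 2 L, kineticDensity (witness hL hε).ψ X
      ≤ ∫⁻ X in cellN 2 L, ENNReal.ofReal (witnessConst hL ε ^ 2) *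
          (ENNReal.ofReal ((2 * ε * S) ^ 2) * kineticDensity (pairPer hL).ψ X) := by
        refine lintegral_mono fun X => ?_
        have h1 : kineticDensity (witness hL hε).ψ X =
            ENNReal.ofReal (witnessConst hL ε ^ 2) * kineticDensity (witnessFun hL ε) X := by
          rw [witness_ψ_eq hL hε]
          exact kineticDensity_const_mul (contDiff_witnessFun hL ε) _ hk0 X
        rw [h1]
        exact mul_le_mul' le_rfl (kineticDensity_witnessFun_le hL hε hS X)
    _ = ENNReal.ofReal (witnessConst hL ε ^ 2) * ENNReal.ofReal ((2 * ε * S) ^ 2) *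
          ∫⁻ X in cellN 2 L, kineticDensity (pairPer hL).ψ X := by
        rw [lintegral_const_mul' _ _ ENNReal.ofReal_ne_top, lintegral_const_mul' _ _ ENNReal.ofReal_ne_top]
        ring

end Witness

/-! #### The half-cell geometry at `M = 2` and the kernel of the witness -/

section Kernel

/-- The half-cell `∏_k [x_k b, (x_k+1) b)` of the torus cell of side `2b`. [folklore] -/
def halfCell (b : ℝ) (x : Fin 3 → Fin 2) : Set Space :=
  {ξ : Space | ∀ k, ξ k ∈ Set.Ico (((x k : ℕ) : ℝ) * b) ((((x k : ℕ) : ℝ) + 1) * b)}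

/-- The cell pair `C_x × C_y ⊂ (ℝ³)²`. [folklore] -/
def cellPairSet (b : ℝ) (x y : Fin 3 → Fin 2) : Set (Config 2) :=
  {X : Config 2 | X 0 ∈ halfCell b x ∧ X 1 ∈ halfCell b y}

theorem measurableSet_halfCell (b : ℝ) (x : Fin 3 → Fin 2) : MeasurableSet (halfCell b x) := by
  have : halfCell b x = ⋂ k : Fin 3, (fun ξ : Space => ξ k) ⁻¹'
      Set.Ico (((x k : ℕ) : ℝ) * b) ((((x k : ℕ) : ℝ) + 1) * b) := by
    ext ξ; simp [halfCell]
  rw [this]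
  exact MeasurableSet.iInter fun k => measurableSet_Ico.preimage (by fun_prop)

theorem volume_halfCell (b : ℝ) (x : Fin 3 → Fin 2) :
    volume (halfCell b x) = ENNReal.ofReal b ^ 3 := by
  have h : halfCell b x = (@WithLp.ofLp 2 (Fin 3 → ℝ)) ⁻¹'
      (Set.univ.pi fun k => Set.Ico (((x k : ℕ) : ℝ) * b) ((((x k : ℕ) : ℝ) + 1) * b)) := by
    ext ξ; simp [halfCell]
  rw [h, (PiLp.volume_preserving_ofLp (Fin 3)).measure_preimage
    (MeasurableSet.univ_pi fun _ => measurableSet_Ico).nullMeasurableSet, volume_pi_pi]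
  have hk : ∀ k : Fin 3, volume (Set.Ico (((x k : ℕ) : ℝ) * b) ((((x k : ℕ) : ℝ) + 1) * b)) =
      ENNReal.ofReal b := by
    intro k; rw [Real.volume_Ico]; congr 1; ring
  simp only [hk, Finset.prod_const, Finset.card_univ, Fintype.card_fin]

theorem cellPairSet_eq_pi (b : ℝ) (x y : Fin 3 → Fin 2) :
    cellPairSet b x y = Set.univ.pi fun i : Fin 2 => if i = 0 then halfCell b x else halfCell b y := by
  ext X
  simp only [cellPairSet, Set.mem_setOf_eq, Set.mem_pi, Set.mem_univ, true_implies, Fin.forall_fin_two,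
    Fin.isValue, if_true, show (1 : Fin 2) ≠ 0 from by decide, if_false]

theorem measurableSet_cellPairSet (b : ℝ) (x y : Fin 3 → Fin 2) : MeasurableSet (cellPairSet b x y) := by
  rw [cellPairSet_eq_pi]
  exact MeasurableSet.univ_pi fun i => by split_ifs <;> exact measurableSet_halfCell b _

theorem volume_cellPairSet (b : ℝ) (x y : Fin 3 → Fin 2) :
    volume (cellPairSet b x y) = (ENNReal.ofReal b ^ 3) ^ 2 := by
  rw [cellPairSet_eq_pi, volume_pi_pi]
  simp only [Fin.prod_univ_two, Fin.isValue, if_true, show (1 : Fin 2) ≠ 0 from by decide, if_false,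
    volume_halfCell b]
  ring

theorem volume_cellPairSet_lt_top (b : ℝ) (x y : Fin 3 → Fin 2) :
    volume (cellPairSet b x y) < ⊤ := by
  rw [volume_cellPairSet b]
  exact ENNReal.pow_lt_top (ENNReal.pow_lt_top ENNReal.ofReal_lt_top)

/-- Half-cells lie in the torus cell of side `2b`. [folklore] -/
theorem halfCell_subset_cell {b : ℝ} (hb : 0 ≤ b) (x : Fin 3 → Fin 2) : halfCell b x ⊆ cell (((2 : ℕ) : ℝ) * b) := by
  intro ξ hξ k
  have h := hξ k
  have hx : ((x k : ℕ) : ℝ) ≤ 1 := by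
    have := (x k).isLt
    exact_mod_cast Nat.lt_succ_iff.mp this
  have hx0 : (0 : ℝ) ≤ ((x k : ℕ) : ℝ) := by positivity
  refine ⟨le_trans (by positivity) h.1, lt_of_lt_of_le h.2 ?_⟩
  push_cast
  nlinarith

theorem cellPairSet_subset_cellN {b : ℝ} (hb : 0 ≤ b) (x y : Fin 3 → Fin 2) :
    cellPairSet b x y ⊆ cellN 2 (((2 : ℕ) : ℝ) * b) := by
  intro X hX i
  fin_cases i
  · exact halfCell_subset_cell hb x hX.1
  · exact halfCell_subset_cell hb y hX.2

/-- Where the dilated pair (side `2b`) is non-zero, both particles are in the first half-cell. [folklore] -/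
theorem mem_cellPairSet_zero_of_ne_zero {b : ℝ} (hb : 0 < b) {X : Config 2}
    (h : (dilatedPair (L := ((2 : ℕ) : ℝ) * b) (by positivity)).ψ X ≠ 0) : X ∈ cellPairSet b 0 0 := by
  have hc : ∀ i k, 0 ≤ X i k ∧ X i k < b := by
    intro i k
    have := dilatedPair_support (L := ((2 : ℕ) : ℝ) * b) (by positivity) h i k
    push_cast at this
    constructor <;> nlinarith [this.1, this.2]
  simp only [cellPairSet, halfCell, Set.mem_setOf_eq, Pi.zero_apply, Fin.val_zero, Nat.cast_zero,
    zero_mul, zero_add, one_mul, Set.mem_Ico]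
  exact ⟨fun k => hc 0 k, fun k => hc 1 k⟩

/-- Distinct half-cells are disjoint. [folklore] -/
theorem eq_of_mem_halfCell {b : ℝ} (hb : 0 < b) {x x' : Fin 3 → Fin 2} {ξ : Space}
    (h : ξ ∈ halfCell b x) (h' : ξ ∈ halfCell b x') : x = x' := by
  funext k
  have h1 := h k
  have h2 := h' k
  -- the integer parts `x k`, `x' k` of `ξ k / b` agree
  by_contra hne
  have : (x k : ℕ) ≠ (x' k : ℕ) := fun e => hne (Fin.ext e)
  rcases Nat.lt_or_gt_of_ne this with hlt | hlt
  · have : ((x k : ℕ) : ℝ) + 1 ≤ ((x' k : ℕ) : ℝ) := by exact_mod_cast hlt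
    nlinarith [h1.2, h2.1]
  · have : ((x' k : ℕ) : ℝ) + 1 ≤ ((x k : ℕ) : ℝ) := by exact_mod_cast hlt
    nlinarith [h2.2, h1.1]

/-- Off the diagonal pair `(0,0)` the dilated pair vanishes on `C_x × C_y`. [folklore] -/
theorem dilatedPair_eq_zero_of_mem {b : ℝ} (hb : 0 < b) {x y : Fin 3 → Fin 2} (hxy : ¬ (x = 0 ∧ y = 0))
    {X : Config 2} (hX : X ∈ cellPairSet b x y) :
    (dilatedPair (L := ((2 : ℕ) : ℝ) * b) (by positivity)).ψ X = 0 := by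
  by_contra h
  have h0 := mem_cellPairSet_zero_of_ne_zero hb h
  exact hxy ⟨(eq_of_mem_halfCell hb hX.1 h0.1), (eq_of_mem_halfCell hb hX.2 h0.2)⟩

/-- `∫ |Θ|² = 1` as a Bochner integral. [folklore] -/
theorem integral_norm_sq_dilatedPair {L : ℝ} (hL : 0 < L) :
    ∫ X, ‖(dilatedPair hL).ψ X‖ ^ 2 = 1 := by
  have hc : Continuous fun X => ‖(dilatedPair hL).ψ X‖ ^ 2 :=
    (dilatedPair hL).contDiff.continuous.norm.pow 2
  rw [integral_eq_lintegral_of_nonneg_ae (f := fun X => ‖(dilatedPair hL).ψ X‖ ^ 2)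
    (Filter.Eventually.of_forall fun X => by positivity) hc.aestronglyMeasurable]
  have : ∀ X, ENNReal.ofReal (‖(dilatedPair hL).ψ X‖ ^ 2) = ((‖(dilatedPair hL).ψ X‖₊ : ℝ≥0∞)) ^ 2 :=
    fun X => (coe_nnnorm_sq_eq_ofReal _).symm
  simp_rw [this, (dilatedPair hL).norm_eq, ENNReal.toReal_one]

theorem integrable_norm_sq_dilatedPair {L : ℝ} (hL : 0 < L) :
    Integrable fun X => ‖(dilatedPair hL).ψ X‖ ^ 2 := by
  refine Continuous.integrable_of_hasCompactSupport ((dilatedPair hL).contDiff.continuous.norm.pow 2) ?_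
  exact (hasCompactSupport_dilatedPair hL).norm.comp_left (g := fun r : ℝ => r ^ 2) (by simp)

/-- The cell-pair integrals of `|Θ|²`: `1` on `(0,0)`, `0` elsewhere. [folklore] -/
theorem setIntegral_norm_sq_dilatedPair {b : ℝ} (hb : 0 < b) (x y : Fin 3 → Fin 2) :
    ∫ X in cellPairSet b x y, ‖(dilatedPair (L := ((2 : ℕ) : ℝ) * b) (by positivity)).ψ X‖ ^ 2 =
      if x = 0 ∧ y = 0 then 1 else 0 := by
  split_ifs with hxy
  · obtain ⟨rfl, rfl⟩ := hxy
    rw [setIntegral_eq_integral_of_forall_compl_eq_zero, integral_norm_sq_dilatedPair]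
    intro X hX
    have : (dilatedPair (L := ((2 : ℕ) : ℝ) * b) (by positivity)).ψ X = 0 := by
      by_contra h
      exact hX (mem_cellPairSet_zero_of_ne_zero hb h)
    simp [this]
  · refine setIntegral_eq_zero_of_forall_eq_zero fun X hX => ?_
    simp [dilatedPair_eq_zero_of_mem hb hxy hX]

/-- **The kernel of the witness**: `K(x,y) = k_ε (b⁶ + ε [x = y = 0])`. [folklore] -/
theorem kernel_witness {b : ℝ} (hb : 0 < b) {ε : ℝ} (hε : 0 ≤ ε) (x y : Fin 3 → Fin 2) :
    ∫ X in cellPairSet b x y, ((witness (L := ((2 : ℕ) : ℝ) * b) (by positivity) hε).ψ X).re =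
      witnessConst (L := ((2 : ℕ) : ℝ) * b) (by positivity) ε *
        (b ^ 6 + ε * if x = 0 ∧ y = 0 then 1 else 0) := by
  have hL : 0 < ((2 : ℕ) : ℝ) * b := by positivity
  set k := witnessConst hL ε with hk
  set Θ := dilatedPair hL with hΘ
  have hvol := volume_cellPairSet b x y
  have hvolR : (volume (cellPairSet b x y)).toReal = b ^ 6 := by
    rw [hvol, ENNReal.toReal_pow, ENNReal.toReal_pow, ENNReal.toReal_ofReal hb.le]; ring
  -- on the cell pair the witness is `k (1 + ε |Θ|²)`
  have heq : Set.EqOn (fun X => ((witness hL hε).ψ X).re)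
      (fun X => k + (k * ε) * ‖Θ.ψ X‖ ^ 2) (cellPairSet b x y) := by
    intro X hX
    have hXc : X ∈ cellN 2 (((2 : ℕ) : ℝ) * b) := cellPairSet_subset_cellN hb.le x y hX
    simp only []
    rw [witness_ψ, Complex.mul_re, witnessFun_re, witnessFun_im, Complex.ofReal_re, Complex.ofReal_im,
      pairPer_ψ_of_mem hL hXc]
    ring
  rw [setIntegral_congr_fun (measurableSet_cellPairSet b x y) heq]
  have hint : IntegrableOn (fun X => (k * ε) * ‖Θ.ψ X‖ ^ 2) (cellPairSet b x y) :=
    ((integrable_norm_sq_dilatedPair hL).const_mul (k * ε)).integrableOn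
  have hconst : IntegrableOn (fun _ : Config 2 => k) (cellPairSet b x y) :=
    integrableOn_const (hs := (volume_cellPairSet_lt_top b x y).ne)
  rw [integral_add hconst hint, setIntegral_const, measureReal_def, hvolR, integral_const_mul,
    setIntegral_norm_sq_dilatedPair hb x y, smul_eq_mul]
  ring

end Kernel

/-! #### The refutation (statement = `CardTwoBodyCellLorentzian` unfolded) -/

/-- `v = 0` is an admissible (repulsive, finite-range) potential. [folklore] -/
theorem isRepulsiveFiniteRange_zero : IsRepulsiveFiniteRange (0 : ℝ → ℝ≥0∞) :=
  ⟨measurable_const, 0, fun _ _ => rfl⟩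

/-- **The card's First lemma `TwoBodyCellLorentzian` (coarse-cell-lorentzian, IdeatorSketch1) is
false as typed.** At `v = 0` the witness `Ψ_ε = k_ε (1 + ε |Θ_per|²)` — `Θ` the two-body block state
in the first half-cell, `ε > 0` small — is a real non-negative `δ`-near-minimiser of the free periodic
two-body energy on the torus of side `2b₀` whose cell-pair kernel `k_ε(b₀⁶ + ε[x = y = 0])` violates the
reverse Cauchy–Schwarz (Lorentzian) inequality at `u = e_0 - e_1` (`bumpKernel_not_lorentzian`).
Misstated-class refutation: repaired by `0 < scatteringLength v` (then signature is strict, hence open)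
or by the exact-minimiser form (`PairCellLorentzian`); the witness misses both. [folklore] -/
theorem not_twoBodyCellLorentzian :
    ¬ (∀ v : ℝ → ENNReal, IsRepulsiveFiniteRange v →
      ∃ b₀ : ℝ, 0 < b₀ ∧ ∀ b : ℝ, b₀ ≤ b → ∀ M : ℕ, 2 ≤ M →
        ∃ δ : ENNReal, 0 < δ ∧ ∀ Ψ : PeriodicTrialState 2 ((M : ℝ) * b),
          (∀ X, 0 ≤ (Ψ.ψ X).re ∧ (Ψ.ψ X).im = 0) →
          periodicEnergy v Ψ ≤ periodicGroundStateEnergy v 2 ((M : ℝ) * b) + δ →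
          let K : (Fin 3 → Fin M) → (Fin 3 → Fin M) → ℝ :=
            fun x y => ∫ X in {X : Config 2 | X 0 ∈ {ξ : Space | ∀ k, ξ k ∈ Set.Ico (((x k : ℕ) : ℝ) * b) ((((x k : ℕ) : ℝ) + 1) * b)} ∧
                                X 1 ∈ {ξ : Space | ∀ k, ξ k ∈ Set.Ico (((y k : ℕ) : ℝ) * b) ((((y k : ℕ) : ℝ) + 1) * b)}},
              (Ψ.ψ X).re
          ∀ u : (Fin 3 → Fin M) → ℝ,
            (∑ x, ∑ y, K x y) * (∑ x, ∑ y, u x * K x y * u y) ≤ (∑ x, ∑ y, K x y * u y) ^ 2) := by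
  intro h
  obtain ⟨b₀, hb₀, hb⟩ := h 0 isRepulsiveFiniteRange_zero
  obtain ⟨δ, hδ, hΨ⟩ := hb b₀ le_rfl 2 le_rfl
  have hL : 0 < ((2 : ℕ) : ℝ) * b₀ := by positivity
  obtain ⟨S, hS0, hS⟩ := exists_bound_dilatedPair hL
  -- the energy budget: `𝓔[Ψ_ε] ≤ ε² C`
  have hEtop : periodicEnergy 0 (pairPer hL) ≠ ⊤ := (periodicEnergy_pairPer_lt_top hL).ne
  set C : ℝ := ((((2 : ℕ) : ℝ) * b₀) ^ 6)⁻¹ * (2 * S) ^ 2 * (periodicEnergy 0 (pairPer hL)).toReal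
    with hC
  have hC0 : 0 ≤ C := by positivity
  -- choice of ε
  obtain ⟨ε, hε0, hε1, hεδ⟩ : ∃ ε : ℝ, 0 < ε ∧ ε ≤ 1 ∧ ENNReal.ofReal (ε ^ 2 * C) ≤ δ := by
    by_cases hδtop : δ = ⊤
    · exact ⟨1, one_pos, le_rfl, hδtop ▸ le_top⟩
    · have hδr : 0 < δ.toReal := ENNReal.toReal_pos hδ.ne' hδtop
      refine ⟨min 1 (δ.toReal / (C + 1)), lt_min one_pos (by positivity), min_le_left _ _, ?_⟩
      refine (ENNReal.ofReal_le_ofReal ?_).trans (ENNReal.ofReal_toReal hδtop).le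
      set ε := min 1 (δ.toReal / (C + 1)) with hεdef
      have hε0 : 0 ≤ ε := by positivity
      have hε1 : ε ≤ 1 := min_le_left _ _
      have hε2 : ε ≤ δ.toReal / (C + 1) := min_le_right _ _
      have hε3 : ε * (C + 1) ≤ δ.toReal := by rwa [le_div_iff₀ (by positivity)] at hε2
      calc ε ^ 2 * C ≤ ε * C := by nlinarith [mul_le_mul_of_nonneg_right hε1 (mul_nonneg hε0 hC0)]
        _ ≤ ε * (C + 1) := by nlinarith
        _ ≤ δ.toReal := hε3
  have hε : 0 ≤ ε := hε0.le
  -- the witness is a near-minimiser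
  have hener : periodicEnergy 0 (witness hL hε) ≤
      periodicGroundStateEnergy 0 2 (((2 : ℕ) : ℝ) * b₀) + δ := by
    refine le_add_left (le_trans (periodicEnergy_witness_le hL hε hS) (le_trans ?_ hεδ))
    have hk := witnessConst_sq_le hL hε
    calc ENNReal.ofReal (witnessConst hL ε ^ 2) * ENNReal.ofReal ((2 * ε * S) ^ 2) *
          periodicEnergy 0 (pairPer hL)
        = ENNReal.ofReal (witnessConst hL ε ^ 2 * (2 * ε * S) ^ 2 *
            (periodicEnergy 0 (pairPer hL)).toReal) := by
          rw [ENNReal.ofReal_mul (by positivity), ENNReal.ofReal_mul (by positivity),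
            ENNReal.ofReal_toReal hEtop]
      _ ≤ ENNReal.ofReal (ε ^ 2 * C) := by
          refine ENNReal.ofReal_le_ofReal ?_
          calc witnessConst hL ε ^ 2 * (2 * ε * S) ^ 2 * (periodicEnergy 0 (pairPer hL)).toReal
              = witnessConst hL ε ^ 2 * (ε ^ 2 * (2 * S) ^ 2 * (periodicEnergy 0 (pairPer hL)).toReal) := by
                ring
            _ ≤ ((((2 : ℕ) : ℝ) * b₀) ^ 6)⁻¹ *
                  (ε ^ 2 * (2 * S) ^ 2 * (periodicEnergy 0 (pairPer hL)).toReal) :=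
                mul_le_mul_of_nonneg_right hk (by positivity)
            _ = ε ^ 2 * C := by rw [hC]; ring
  -- the card's conclusion for the witness, at `u = e_0 - e_1`
  set z : Fin 3 → Fin 2 := fun _ => 1 with hz
  have h0z : (0 : Fin 3 → Fin 2) ≠ z := by
    intro h0; have := congr_fun h0 0; simp [hz] at this
  have hcard := hΨ (witness hL hε) (witness_real_nonneg hL hε) hener
    (fun x => (if x = 0 then 1 else 0) - if x = z then 1 else 0)
  -- rewrite the kernel
  have hK : ∀ x y : Fin 3 → Fin 2,
      (∫ X in cellPairSet b₀ x y, ((witness hL hε).ψ X).re) =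
        witnessConst hL ε * b₀ ^ 6 + if x = 0 ∧ y = 0 then witnessConst hL ε * ε else 0 := by
    intro x y
    rw [kernel_witness hb₀ hε x y]
    split_ifs <;> ring
  have hcard' : (∑ x, ∑ y, (∫ X in cellPairSet b₀ x y, ((witness hL hε).ψ X).re)) *
      (∑ x, ∑ y, ((if x = 0 then 1 else 0) - if x = z then (1 : ℝ) else 0) *
        (∫ X in cellPairSet b₀ x y, ((witness hL hε).ψ X).re) *
        ((if y = 0 then 1 else 0) - if y = z then (1 : ℝ) else 0)) ≤
      (∑ x, ∑ y, (∫ X in cellPairSet b₀ x y, ((witness hL hε).ψ X).re) *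
        ((if y = 0 then 1 else 0) - if y = z then (1 : ℝ) else 0)) ^ 2 := hcard
  simp only [hK] at hcard'
  have hlt := bumpKernel_not_lorentzian (ι := Fin 3 → Fin 2) h0z
    (P := witnessConst hL ε * b₀ ^ 6) (Q := witnessConst hL ε * ε)
    (mul_pos (witnessConst_pos hL hε) (by positivity)) (mul_pos (witnessConst_pos hL hε) hε0)
  simp only [] at hlt
  linarith


/-- Verbatim restatement of the card's First lemma `TwoBodyCellLorentzian`
(`IdeatorSketch1.lean`, namespace `…Cruxes.LatticeToPeriodicBridge.CoarseCellLorentzian`), over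
tree vocabulary, so that its refutation can be recorded in this self-contained work file. -/
def CardTwoBodyCellLorentzian : Prop :=
  ∀ v : ℝ → ENNReal, IsRepulsiveFiniteRange v →
    ∃ b₀ : ℝ, 0 < b₀ ∧ ∀ b : ℝ, b₀ ≤ b → ∀ M : ℕ, 2 ≤ M →
      ∃ δ : ENNReal, 0 < δ ∧ ∀ Ψ : PeriodicTrialState 2 ((M : ℝ) * b),
        (∀ X, 0 ≤ (Ψ.ψ X).re ∧ (Ψ.ψ X).im = 0) →
        periodicEnergy v Ψ ≤ periodicGroundStateEnergy v 2 ((M : ℝ) * b) + δ →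
        let K : (Fin 3 → Fin M) → (Fin 3 → Fin M) → ℝ :=
          fun x y => ∫ X in {X : Config 2 | X 0 ∈ {ξ : Space | ∀ k, ξ k ∈ Set.Ico (((x k : ℕ) : ℝ) * b) ((((x k : ℕ) : ℝ) + 1) * b)} ∧
                              X 1 ∈ {ξ : Space | ∀ k, ξ k ∈ Set.Ico (((y k : ℕ) : ℝ) * b) ((((y k : ℕ) : ℝ) + 1) * b)}},
            (Ψ.ψ X).re
        ∀ u : (Fin 3 → Fin M) → ℝ,
          (∑ x, ∑ y, K x y) * (∑ x, ∑ y, u x * K x y * u y) ≤ (∑ x, ∑ y, K x y * u y) ^ 2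

/-- **REFUTED (gen 2, sorry-free).** `CardTwoBodyCellLorentzian` is false: `v = 0`, `b = b₀`,
`M = 2`, and for the offered `δ` the bump witness `Ψ_ε = k_ε(1 + ε|Θ_per|²)` (block state of
`BoseGasCatStates` dilated into the first half-cell; `not_twoBodyCellLorentzian` above) with `ε`
so small that its purely kinetic energy is `≤ δ`; its kernel is `k_ε(b₀⁶ + ε[x = y = 0])` and
`bumpKernel_not_lorentzian` is the violated instance `u = e_0 - e_1`. (The trigonometric witness
`c_ε(1 + ε sin sin)` of the prose, with `reverseCauchySchwarz_fails_eightCells`, is the same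
phenomenon.) Misstated-class: repaired by `0 < scatteringLength v` or by the exact-minimiser form.
[folklore] -/
theorem not_cardTwoBodyCellLorentzian : ¬ CardTwoBodyCellLorentzian :=
  not_twoBodyCellLorentzian

/-! ### §8b `coarse-cell-hardcore-floor`: nothing to hit below the bet

`CoarseModesCarryAlmostAll` (`N - Σ_m⟨χ_m,γχ_m⟩ ≤ (b/π)² T`, sharp Neumann gap of the cube, equality
for the `L`-periodic `C¹` mode `cos(πMx₁/L)`, `M` even) and `CrossCellPoincare` (`D ≤ 2b²T`; on a
plane wave the ratio is `sin⁴θ/(2θ⁴) ≤ ½`) are true Poincaré facts; `exists_even_sliver` and the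
composition `latticeToPeriodicBridge_of_floor` are kernel-checked in the sketch. The bet
`CoarseHardCoreFloor` is `∀ᶠ N` (no finite refutation) and, fed with Tóth's ceiling, sits between
"torus condensate fraction `≥ ½ + 2η`" and "fraction `≥ c/4`": PeriodicBEC-hard, consistent with
`not_crux_iff`. Normalisation check passed (`xyZeroModeWeight M 1 = M³`: one free hard-core boson
has `⟨S⁺_totS⁻_tot⟩ = M³`; at `N = 2`, `M = 2` the XY side lives on the cube graph `Q₃` with doubled
bonds, harmless). No negative lemma filed against this card.

### §8c `muffin-tin-reward-supermodularity`: LDM₀ under a wider ED scan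

Typed First lemma (from the card text): `WallsOnlyDeplete` — for ALL `v` admissible, `N`, and ALL
`L, b, w` (`0 < w < 1`), `λ ↦ twoCouplingCondensate v N L b w λ 0` is non-increasing on `[0, ∞)`,
where the wall set `{x | ∃ k, fract(x_k/b) < w}` is drawn on `[0,L)³` and `L`-periodised — so
INCOMMENSURATE `L/b` (one defect well or one thick wall per direction) and `b > L` (a single box well)
are inside the statement although the glue `BridgeFromWalls` only uses `L = M b`. Junk corners
checked: `E = ⊤` (hard spheres that do not fit) makes `twoCouplingCondensate ≡ 0` on both sides;
`N = 0, 1` fine; ground states unique and positive (stoquastic), so the `⨆δ ⨅Ψ` bookkeeping returns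
the ground-state value. On paper the only `n₀`-INCREASING mechanism is an avoided crossing between
two inequivalent competing wells (the crossing state is spread over both, raising `(∫u)²/∫u²`
transiently); the typed geometry has all bulk wells equivalent plus ONE defect per direction, which
never competes (`N = 1`: expected monotone). Numerical scan beyond the card's caricature
(j008682: `N ≤ 4`, `2³` cells): kit job **j010771** (resubmission of the cancelled j010199) (`exp/ldm0_scan.py`, this seat) — fine-grid
finite differences, `N = 1` (`d = 1`: 44 geometries × 45 depths incl. `L/b ∈ {2.3, 2.5, 2.77, 3.4,
5.3, 1.5, 1.2, 0.8, 0.55}`; `d = 3`: muffin tin `28³`), `N = 2` (`d = 1`, `160²`, soft cores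
`U ∈ {5,20,200}`, hard cores `r₀ ∈ {0.25, 0.5}b`, 8 geometries; `d = 2` coarse), `N = 3` (`d = 1`,
`44³`), tolerance `10⁻⁷` relative, flagged cases re-run on refined grids. RESULT: PENDING — at this
publication the job has been waiting > 70 min in a saturated queue (≈ 1 800 queued jobs of higher
priority); its summary (`ldm0_scan_results.json`: per case the `n₀(λ)` table, every increase beyond
tolerance, refinement re-runs) auto-attaches to the item when it runs, and this seat — or the next —
folds it in here. Until then LDM₀ stands UNTESTED beyond the card's own caricature j008682 (no
violation at `N ≤ 4`, `2³` cells). A robust increase in a COMMENSURATE interacting case would be substantive for the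
line; an increase confined to incommensurate `(L,b)` would make `WallsOnlyDeplete` misstated
(repair `L = M·b`), leaving the card's chain intact.

## §9 Census update (gen 2)

SCALING (landed separately, `Negative/ScalingReduction.lean`, p78254; no duplicate here): the
consequent's body is EXACTLY dilation covariant — a threshold `ρ₀` for `v` is a threshold `ρ₀/b³`
for LSSY's `b⁻²v(·/b)` with the same `c` and slack `b⁻²δ` (`consequentBody_scaledPotential`, from the
tree's `iInf_condensateOccupation_scaledPotential_le`), `ConsequentAt (b⁻²v(·/b)) ↔ ConsequentAt v`,
`a⁻²·hardCorePotential 1 (·/a) = hardCorePotential a`; hence `PeriodicBEC` and the crux both reduce to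
admissible potentials of range `≤ 1` (`periodicBEC_iff_unitRange`, `crux_iff_unitRange`): any prover
may normalise the range, any refuter may look for a bad potential among unit-range ones, and §7's
`ρ₀(hardCorePotential a)·a³ ≤ 8` is the `a`-orbit of the single number `ρ₀(hardCorePotential 1) ≤ 8`.


VERDICT: RESISTS (unchanged): `¬crux ↔ KineticLatticeBEC ∧ ¬PeriodicBEC`. New formal negative
knowledge: (1) every `v`-uniform-threshold bridge is `↔ ¬A` (§7, landed p76026), completing §4's
list (energy windows `κN`, `κL²`, `κ(ρ)N`; now also `∃ρ₀∀v`); quantitatively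
`ρ₀(hardCorePotential a)·a³ ≤ 8` for ANY proof. (2) On the coarse-cell-Lorentzian line the
near-minimiser signature statement is false at `a = 0` (§8a): positivity of the scattering length
is load-bearing from `N = 2` on, and robustness in `δ` cannot come from openness of signature
uniformly in `v`. WHAT THE CARDS CHANGE IN §6's PICTURE: all three cards either prove the consequent
outright with `A` unused (coarse-cell-lorentzian: "ranks 2+3 one scale up"), or consume `A` once as a
floor/anchor and leave ONE comparison inequality between two ground states of different kind
(`CoarseHardCoreFloor`; `WallsOnlyDeplete` = LDM₀) — exactly §6's "(β) comparison sign", now typed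
three ways. None of the three residual inequalities is decidable by finite computation in the
direction of refutation except LDM₀ at fixed `(N, L)` (j010771) and block-signature at fixed
`(N, M)` (the card's own jobs j008354/j008608/j008609); a refuter's standing recommendation to
crux-plan is therefore to file LDM₀ / block-signature as the attackable stubs and to carry
`0 < scatteringLength v` explicitly wherever signature is claimed for near-minimisers.
-/

end Summit.AtomisticToContinuum.BoseEinsteinCondensation.Cruxes.LatticeToPeriodicBridge.Disproof

end
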